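import Literature.NumberTheory.Sieve.LinearEquationsInPrimesMainReduction
import Mathlib.MeasureTheory.Measure.Lebesgue.EqHaar
import Mathlib.Data.Nat.Log
import Mathlib.Analysis.Complex.ExponentialBounds
import HarnessLib

/-!
# Linear equations in primes: the `W`-trick reduction of §5 (Green–Tao 2010), assembled

Trunk T-SIEVE (`Literature/NumberTheory/Sieve`). B. Green, T. Tao, *Linear equations in primes*,
Ann. of Math. 171 (2010), §5, "Proof of the Main Theorem assuming Theorem 5.1" (pp. 1775–1776)
deduces Thm. 4.5 (primes in affine lattices in `s`-normal form, archimedean factor eliminated)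
from Thm. 5.1 (its `W`-tricked version). This file proves that deduction, i.e. **discharges** the
named fact `Literature.NumberTheory.Sieve.GreenTao2010_mainNormalForm_of_wTricked` (`LinearEquationsInPrimesNormalForm.lean`):
`Literature.NumberTheory.Sieve.GreenTao2010_mainNormalForm_of_wTricked_holds`.

The printed proof and its rendering here:

1. "We may replace `Λ` by `Λ'` as the contribution of the prime powers is easily seen to be
   negligible": `Literature.NumberTheory.Sieve.card_higherPrimePowers_le` (at most `(√X + 1)(log₂ X + 1)` prime powers
   `p^k ≤ X`, `k ≥ 2`) and `Literature.NumberTheory.Sieve.vonMangoldtSum_sub_primeSum_le`.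
2. "`∏_p β_p = ∏_{p ≤ w} β_p + o(1) = β_W + o(1)`" (Lemma 1.3 and multiplicativity):
   `singularProduct_sub_partial_uniform` and `localFactor_primorial` (sibling files). Since the
   estimate of Thm. 5.1 is uniform in the range `w₀ ≤ w ≤ ½ log log N`, a *constant* cutoff
   `w = max(w₀, w₁(ε))` suffices, and `W = ∏_{p ≤ w} p` is then a constant.
3. "`β_W = (W/φ(W))ᵗ |A| / W^d`", `A = {a ∈ [W]^d : gcd(ψᵢ(a), W) = 1 ∀ i}` (from (1.6)):
   `Literature.NumberTheory.Sieve.localFactor_eq_card_coprimeResidues`.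
4. The expansion `n = W m + a`, `a ∈ [W]^d` (here `a ∈ {0, …, W-1}^d`):
   `Literature.sum_latticeBox_filter_eq_sum_residues`, with the bodies `K̃_a = (K - a)/W`
   (`Literature.NumberTheory.Sieve.wTrickBody`; convex, `⊆ [-Ñ, Ñ]^d` for `Ñ = ⌊N/W⌋ + 2`, of volume `W^{-d} vol K`);
   for `a ∉ A` the summand vanishes (`ψᵢ(Wm + a) > N^{8/10} ≥ W` shares a prime `≤ w` with `W`),
   and for `a ∈ A`, `ψᵢ(W m + a) = W ψ̃_{i,a}(m) + bᵢ(a)` with `bᵢ(a) ∈ [W]` coprime to `W`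
   (`Literature.NumberTheory.Sieve.wTrickResidue`, `Literature.NumberTheory.Sieve.AffLinForm.wTrickShift`: same linear part, constant
   `⌊(ψᵢ(a) - 1)/W⌋`), so that `Λ'(ψᵢ(Wm + a)) = (W/φ(W)) Λ'_{bᵢ(a),W}(ψ̃_{i,a}(m))`.
5. Thm. 5.1 for each `a ∈ A` at scale `Ñ` (the `ψ̃_{i,a}` are in `s`-normal form, of size
   `‖Ψ̃_a‖_Ñ ≤ L + t(2L + 2)`, and `> Ñ^{7/10}` on `K̃_a`), summed with weight `(W/φ(W))ᵗ`:
   the total error is `|A| (W/φ(W))ᵗ ε' Ñ^d = β_W W^d ε' Ñ^d ≤ B 2^d ε' N^d`.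
6. "A simple volume-packing argument": `#(K̃_a ∩ ℤ^d) = W^{-d} vol K + O(Ñ^{d-1})` and
   `#(K ∩ ℤ^d) = vol K + O(N^{d-1})` (App. A, `ConvexBodyLatticePoints`), so the main terms
   `∑_{a ∈ A} (W/φ(W))ᵗ #(K̃_a ∩ ℤ^d)` and `#(K ∩ ℤ^d) β_W` agree up to `O_W(N^{d-1})`.

## References

* B. Green, T. Tao, *Linear equations in primes*, Ann. of Math. (2) 171 (2010), 1753–1850
  (arXiv:math/0606088): §5 — (5.1), `Λ'`, `Λ'_{b,W}`, Thm. 5.1 and "Proof of the Main Theorem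
  assuming Theorem 5.1" ((5.2)–(5.7)); Lemma 1.3, (1.6); Thm. 4.5; App. A.
-/

noncomputable section

open Filter Finset MeasureTheory
open scoped Topology

namespace Literature.NumberTheory.Sieve

variable {d t : ℕ}

/-! ### Normal form implies finite complexity -/

/-- A system in `s`-normal form has finite complexity: no two linear parts are parallel ("it is,
therefore, necessary that a system be of a finite complexity `s` before admitting an `s`-normal
form"). [cite: GreenTao2010, §4 (after Def. 4.2)] -/
theorem IsNormalForm.isFiniteComplexitySystem {s : ℕ} {Ψ : Fin t → AffLinForm d}
    (h : IsNormalForm s Ψ) : IsFiniteComplexitySystem Ψ := by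
  have key : ∀ i j : Fin t, i ≠ j → ∀ a b : ℤ, a • (Ψ i).coeff = b • (Ψ j).coeff → a = 0 := by
    intro i j hij a b hab
    obtain ⟨J, -, hJi, hJ⟩ := h i
    obtain ⟨e, heJ, he⟩ := Finset.prod_eq_zero_iff.mp (hJ j (Ne.symm hij))
    have hie : (Ψ i).coeff e ≠ 0 := fun h0 => hJi (Finset.prod_eq_zero heJ h0)
    have := congr_fun hab e
    simp only [Pi.smul_apply, smul_eq_mul, he, mul_zero] at this
    exact (mul_eq_zero.mp this).resolve_right hie
  intro i j hij a b hab
  exact ⟨key i j hij a b hab, key j i (Ne.symm hij) b a hab.symm⟩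

/-! ### Prime powers are negligible: `Λ` versus `Λ'` -/

/-- The prime powers `p^k ≤ X` with `k ≥ 2` number at most `(√X + 1)(log₂ X + 1)`
("the (negligible) set of prime powers `p², p³, …`"). [cite: GreenTao2010, §5 (after (5.1))] -/
theorem card_higherPrimePowers_le (X : ℕ) :
    #((Finset.range (X + 1)).filter fun m => IsPrimePow m ∧ ¬ m.Prime) ≤
      (Nat.sqrt X + 1) * (Nat.log 2 X + 1) := by
  classical
  have hsub : (Finset.range (X + 1)).filter (fun m => IsPrimePow m ∧ ¬ m.Prime) ⊆
      ((Finset.range (Nat.sqrt X + 1)) ×ˢ (Finset.range (Nat.log 2 X + 1))).image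
        fun pk => pk.1 ^ (pk.2 + 2) := by
    intro m hm
    rw [Finset.mem_filter, Finset.mem_range] at hm
    obtain ⟨hmX, hpp, hnp⟩ := hm
    rw [isPrimePow_nat_iff] at hpp
    obtain ⟨p, k, hp, hk, rfl⟩ := hpp
    have hk2 : 2 ≤ k := by
      by_contra hcon
      have hk1 : k = 1 := by omega
      subst hk1
      exact hnp (by simpa using hp)
    refine Finset.mem_image.mpr ⟨(p, k - 2), Finset.mem_product.mpr ⟨?_, ?_⟩, ?_⟩
    · rw [Finset.mem_range, Nat.lt_succ_iff, Nat.le_sqrt]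
      calc p * p = p ^ 2 := (sq p).symm
        _ ≤ p ^ k := Nat.pow_le_pow_right hp.pos hk2
        _ ≤ X := by omega
    · rw [Finset.mem_range, Nat.lt_succ_iff]
      have h1 : k ≤ Nat.log 2 (p ^ k) := by
        calc k = Nat.log 2 (2 ^ k) := (Nat.log_pow Nat.one_lt_two k).symm
          _ ≤ Nat.log 2 (p ^ k) := Nat.log_mono_right (Nat.pow_le_pow_left hp.two_le k)
      have h2 : Nat.log 2 (p ^ k) ≤ Nat.log 2 X := Nat.log_mono_right (by omega)
      omega
    · show p ^ (k - 2 + 2) = p ^ k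
      rw [Nat.sub_add_cancel hk2]
  calc #((Finset.range (X + 1)).filter fun m => IsPrimePow m ∧ ¬ m.Prime)
      ≤ #(((Finset.range (Nat.sqrt X + 1)) ×ˢ (Finset.range (Nat.log 2 X + 1))).image
          fun pk => pk.1 ^ (pk.2 + 2)) := Finset.card_le_card hsub
    _ ≤ #((Finset.range (Nat.sqrt X + 1)) ×ˢ (Finset.range (Nat.log 2 X + 1))) :=
        Finset.card_image_le
    _ = (Nat.sqrt X + 1) * (Nat.log 2 X + 1) := by simp

/-- `Λ = Λ'` off the higher prime powers. [cite: GreenTao2010, §5 (after (5.1))] -/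
theorem vonMangoldt_eq_vonMangoldtPrime {m : ℕ} (h : ¬ (IsPrimePow m ∧ ¬ m.Prime)) :
    (ArithmeticFunction.vonMangoldt m : ℝ) = vonMangoldtPrime m := by
  by_cases hp : m.Prime
  · rw [vonMangoldtPrime_prime hp]
  · have hnpp : ¬ IsPrimePow m := fun hpp => h ⟨hpp, hp⟩
    rw [vonMangoldtPrime_of_not_prime hp, ArithmeticFunction.vonMangoldt_eq_zero_iff.mpr hnpp]

/-- `0 ≤ ∏ᵢ Λ'(ψᵢ(n)) ≤ ∏ᵢ Λ(ψᵢ(n))`, with equality unless some `ψᵢ(n)` is a higher prime power.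
[cite: GreenTao2010, §5 (after (5.1))] -/
theorem prod_vonMangoldtPrime_le (Ψ : Fin t → AffLinForm d) (n : Fin d → ℤ) :
    0 ≤ ∏ i, vonMangoldtPrime ((Ψ i).eval n).toNat ∧
      ∏ i, vonMangoldtPrime ((Ψ i).eval n).toNat ≤ ∏ i, intVonMangoldt ((Ψ i).eval n) ∧
      ((∀ i, ¬ (IsPrimePow ((Ψ i).eval n).toNat ∧ ¬ ((Ψ i).eval n).toNat.Prime)) →
        ∏ i, vonMangoldtPrime ((Ψ i).eval n).toNat = ∏ i, intVonMangoldt ((Ψ i).eval n)) := by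
  refine ⟨Finset.prod_nonneg fun i _ => (vonMangoldtPrime_le_vonMangoldt _).1,
    Finset.prod_le_prod (fun i _ => (vonMangoldtPrime_le_vonMangoldt _).1)
      fun i _ => (vonMangoldtPrime_le_vonMangoldt _).2, fun hgood => ?_⟩
  exact Finset.prod_congr rfl fun i _ => (vonMangoldt_eq_vonMangoldtPrime (hgood i)).symm

open Classical in
/-- **Replacing `Λ` by `Λ'`** ("the contribution of the prime powers is easily seen to be
negligible"): for `‖Ψ‖_N ≤ L` (`L ≥ 1` an integer), the von Mangoldt sum and its `Λ'`-version
differ by at most `t (√(2LN) + 1)(log₂(2LN) + 1) (2N+1)^{d-1} log^t(2LN)`: a point contributes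
only if some `ψᵢ(n) ≤ 2LN` is a higher prime power, each value is taken `≤ (2N+1)^{d-1}` times,
and each contribution is `≤ log^t(2LN)`. [cite: GreenTao2010, §5 (Proof of the Main Theorem
assuming Theorem 5.1, first paragraph)] -/
theorem vonMangoldtSum_sub_primeSum_le {Ψ : Fin t → AffLinForm d} (hΨ : IsNondegenerateSystem Ψ)
    {N L : ℕ} (hN : 1 ≤ N) (hL1 : 1 ≤ L) (hL : affLinSize Ψ N ≤ L) (K : Set (Fin d → ℝ)) :
    0 ≤ vonMangoldtSum Ψ K N - ∑ n ∈ (latticeBox d N).filter (fun n => realPoint n ∈ K),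
        ∏ i, vonMangoldtPrime ((Ψ i).eval n).toNat ∧
    vonMangoldtSum Ψ K N - ∑ n ∈ (latticeBox d N).filter (fun n => realPoint n ∈ K),
        ∏ i, vonMangoldtPrime ((Ψ i).eval n).toNat ≤
      t * (((Nat.sqrt (2 * L * N) + 1) * (Nat.log 2 (2 * L * N) + 1) : ℕ) : ℝ) *
        (2 * N + 1) ^ (d - 1) * Real.log (2 * L * N) ^ t := by
  set A := (latticeBox d N).filter (fun n => realPoint n ∈ K) with hA
  set F : (Fin d → ℤ) → ℝ := fun n => ∏ i, intVonMangoldt ((Ψ i).eval n) with hF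
  set F' : (Fin d → ℤ) → ℝ := fun n => ∏ i, vonMangoldtPrime ((Ψ i).eval n).toNat with hF'
  have hdiff : vonMangoldtSum Ψ K N - ∑ n ∈ A, F' n = ∑ n ∈ A, (F n - F' n) := by
    unfold vonMangoldtSum
    rw [Finset.sum_sub_distrib]
  rw [hdiff]
  have hterm : ∀ n, 0 ≤ F n - F' n := fun n => sub_nonneg.mpr (prod_vonMangoldtPrime_le Ψ n).2.1
  refine ⟨Finset.sum_nonneg fun n _ => hterm n, ?_⟩
  -- the bad set: some `ψᵢ(n)` is a higher prime power
  set X : ℕ := 2 * L * N with hX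
  set PP : Finset ℕ := (Finset.range (X + 1)).filter fun m => IsPrimePow m ∧ ¬ m.Prime with hPP
  set Bad : Finset (Fin d → ℤ) :=
    (latticeBox d N).filter fun n => ∃ i, ((Ψ i).eval n).toNat ∈ PP with hBad
  have hLr : (1 : ℝ) ≤ (L : ℝ) := by exact_mod_cast hL1
  have hvals : ∀ n ∈ latticeBox d N, ∀ i, ((Ψ i).eval n).toNat ≤ X := by
    intro n hn i
    have h1 := abs_eval_le_of_affLinSize_le hN hL hn i
    have h2 : (((Ψ i).eval n).toNat : ℝ) ≤ 2 * L * N := by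
      rcases le_or_gt 0 ((Ψ i).eval n) with h0 | h0
      · have : (((Ψ i).eval n).toNat : ℤ) = (Ψ i).eval n := Int.toNat_of_nonneg h0
        have h3 : (((Ψ i).eval n).toNat : ℝ) = ((Ψ i).eval n : ℝ) := by exact_mod_cast this
        rw [h3]
        exact (le_abs_self _).trans h1
      · rw [Int.toNat_eq_zero.mpr h0.le]
        push_cast
        positivity
    have h3 : (((Ψ i).eval n).toNat : ℝ) ≤ ((2 * L * N : ℕ) : ℝ) := by push_cast; exact h2
    exact_mod_cast h3
  -- off the bad set the summand vanishes
  have hgood : ∀ n ∈ A, n ∉ Bad → F n - F' n = 0 := by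
    intro n hn hnB
    have hnbox : n ∈ latticeBox d N := (Finset.mem_filter.mp hn).1
    have hall : ∀ i, ¬ (IsPrimePow ((Ψ i).eval n).toNat ∧ ¬ ((Ψ i).eval n).toNat.Prime) := by
      intro i hi
      refine hnB (Finset.mem_filter.mpr ⟨hnbox, i, Finset.mem_filter.mpr ⟨?_, hi⟩⟩)
      exact Finset.mem_range.mpr (Nat.lt_succ_of_le (hvals n hnbox i))
    rw [hF, hF']
    simp only
    rw [(prod_vonMangoldtPrime_le Ψ n).2.2 hall, sub_self]
  -- size of the bad set
  have hBad_card : (#Bad : ℝ) ≤ t * (((Nat.sqrt X + 1) * (Nat.log 2 X + 1) : ℕ) : ℝ) *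
      (2 * N + 1) ^ (d - 1) := by
    have hsub : Bad ⊆ Finset.univ.biUnion fun i => PP.biUnion fun v =>
        (latticeBox d N).filter fun n => (Ψ i).eval n = v := by
      intro n hn
      obtain ⟨hnbox, i, hi⟩ := Finset.mem_filter.mp hn
      refine Finset.mem_biUnion.mpr ⟨i, Finset.mem_univ i, Finset.mem_biUnion.mpr ⟨_, hi, ?_⟩⟩
      refine Finset.mem_filter.mpr ⟨hnbox, ?_⟩
      have hpos : 0 < ((Ψ i).eval n).toNat := by
        have := (Finset.mem_filter.mp hi).2.1.two_le
        omega
      have h0 : 0 ≤ (Ψ i).eval n := by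
        by_contra hneg
        push Not at hneg
        rw [Int.toNat_eq_zero.mpr hneg.le] at hpos
        exact lt_irrefl 0 hpos
      exact (Int.toNat_of_nonneg h0).symm
    have hcardPP : #PP ≤ (Nat.sqrt X + 1) * (Nat.log 2 X + 1) := card_higherPrimePowers_le X
    have h1 : #Bad ≤ t * (((Nat.sqrt X + 1) * (Nat.log 2 X + 1)) * (2 * N + 1) ^ (d - 1)) := by
      calc #Bad ≤ #(Finset.univ.biUnion fun i => PP.biUnion fun v =>
              (latticeBox d N).filter fun n => (Ψ i).eval n = v) := Finset.card_le_card hsub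
        _ ≤ ∑ i, #(PP.biUnion fun v => (latticeBox d N).filter fun n => (Ψ i).eval n = v) :=
            Finset.card_biUnion_le
        _ ≤ ∑ _i : Fin t, ((Nat.sqrt X + 1) * (Nat.log 2 X + 1)) * (2 * N + 1) ^ (d - 1) := by
            refine Finset.sum_le_sum fun i _ => ?_
            obtain ⟨j, hj⟩ := exists_coeff_ne_zero hΨ i
            calc #(PP.biUnion fun v => (latticeBox d N).filter fun n => (Ψ i).eval n = v)
                ≤ ∑ v ∈ PP, #((latticeBox d N).filter fun n => (Ψ i).eval n = v) :=
                  Finset.card_biUnion_le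
              _ ≤ ∑ _v ∈ PP, (2 * N + 1) ^ (d - 1) :=
                  Finset.sum_le_sum fun v _ => card_filter_eval_eq_le (Ψ i) hj N v
              _ = #PP * (2 * N + 1) ^ (d - 1) := by rw [Finset.sum_const, smul_eq_mul]
              _ ≤ _ := Nat.mul_le_mul_right _ hcardPP
        _ = t * (((Nat.sqrt X + 1) * (Nat.log 2 X + 1)) * (2 * N + 1) ^ (d - 1)) := by
            rw [Finset.sum_const, Finset.card_univ, Fintype.card_fin, smul_eq_mul]
    have h2 : (#Bad : ℝ) ≤ ((t * (((Nat.sqrt X + 1) * (Nat.log 2 X + 1)) * (2 * N + 1) ^ (d - 1)) : ℕ) : ℝ) := by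
      exact_mod_cast h1
    refine h2.trans (le_of_eq ?_)
    push_cast
    ring
  -- each bad point contributes at most `log^t(2LN)`
  have hFle : ∀ n ∈ latticeBox d N, F n - F' n ≤ Real.log (2 * L * N) ^ t := by
    intro n hn
    have h1 := (prod_intVonMangoldt_le hN hLr hL hn).2
    have h2 := (prod_vonMangoldtPrime_le Ψ n).1
    rw [hF, hF']
    simp only
    linarith
  have hlog0 : 0 ≤ Real.log (2 * L * N) ^ t := by
    apply pow_nonneg
    apply Real.log_nonneg
    have : (1 : ℝ) ≤ N := by exact_mod_cast hN
    nlinarith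
  calc ∑ n ∈ A, (F n - F' n) = ∑ n ∈ A ∩ Bad, (F n - F' n) := by
        rw [← Finset.sum_sdiff (Finset.inter_subset_left (s₁ := A) (s₂ := Bad))]
        have : ∑ n ∈ A \ (A ∩ Bad), (F n - F' n) = 0 :=
          Finset.sum_eq_zero fun n hn => by
            obtain ⟨hnA, hnAB⟩ := Finset.mem_sdiff.mp hn
            exact hgood n hnA fun hB => hnAB (Finset.mem_inter.mpr ⟨hnA, hB⟩)
        rw [this, zero_add]
    _ ≤ ∑ _n ∈ A ∩ Bad, Real.log (2 * L * N) ^ t :=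
        Finset.sum_le_sum fun n hn => hFle n (Finset.mem_filter.mp (Finset.mem_inter.mp hn).1).1
    _ = #(A ∩ Bad) * Real.log (2 * L * N) ^ t := by rw [Finset.sum_const, nsmul_eq_mul]
    _ ≤ #Bad * Real.log (2 * L * N) ^ t := by
        refine mul_le_mul_of_nonneg_right ?_ hlog0
        exact_mod_cast Finset.card_le_card Finset.inter_subset_right
    _ ≤ _ := by
        rw [hX] at hBad_card
        exact mul_le_mul_of_nonneg_right hBad_card hlog0

/-! ### The `W`-trick vocabulary: `K̃_a`, `bᵢ(a)`, `ψ̃_{i,a}` -/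

/-- The body `K̃_a := (K - a)/W = {x ∈ ℝ^d : W x + a ∈ K}` of the `W`-trick ("with `N` replaced
by `Ñ = O(N/W)` and `K̃ := (K - a)/W`"). [cite: GreenTao2010, §5 (Proof of the Main Theorem
assuming Theorem 5.1)] -/
def wTrickBody (W : ℕ) (a : Fin d → ℕ) (K : Set (Fin d → ℝ)) : Set (Fin d → ℝ) :=
  {x | (fun j => (W : ℝ) * x j + (a j : ℝ)) ∈ K}

/-- Membership in `K̃_a`. [folklore] -/
theorem mem_wTrickBody {W : ℕ} {a : Fin d → ℕ} {K : Set (Fin d → ℝ)} {x : Fin d → ℝ} :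
    x ∈ wTrickBody W a K ↔ (fun j => (W : ℝ) * x j + (a j : ℝ)) ∈ K :=
  Iff.rfl

/-- `K̃_a` is convex if `K` is (affine preimage). [cite: GreenTao2010, §5] -/
theorem convex_wTrickBody (W : ℕ) (a : Fin d → ℕ) {K : Set (Fin d → ℝ)} (hK : Convex ℝ K) :
    Convex ℝ (wTrickBody W a K) := by
  intro x hx y hy p q hp hq hpq
  have h := hK hx hy hp hq hpq
  have heq : (fun j => (W : ℝ) * (p • x + q • y) j + (a j : ℝ)) =
      p • (fun j => (W : ℝ) * x j + (a j : ℝ)) + q • (fun j => (W : ℝ) * y j + (a j : ℝ)) := by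
    funext j
    simp only [Pi.add_apply, Pi.smul_apply, smul_eq_mul]
    linear_combination (-(a j : ℝ)) * hpq
  show (fun j => (W : ℝ) * (p • x + q • y) j + (a j : ℝ)) ∈ K
  rw [heq]
  exact h

/-- `⌊N/W⌋ + 2 ≥ N/W + 1` (the scale `Ñ` of the `W`-trick covers `(K - a)/W`). [folklore] -/
theorem div_add_one_le_wScale {W : ℕ} (hW : 1 ≤ W) (N : ℕ) :
    (N : ℝ) / W + 1 ≤ ((N / W + 2 : ℕ) : ℝ) := by
  have hWr : (0 : ℝ) < W := by exact_mod_cast hW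
  have h1 : N < N / W * W + W := Nat.lt_div_mul_add hW
  have h2 : (N : ℝ) < ((N / W : ℕ) : ℝ) * W + W := by exact_mod_cast h1
  have h3 : (N : ℝ) / W < ((N / W : ℕ) : ℝ) + 1 := by
    rw [div_lt_iff₀ hWr]
    linarith
  push_cast
  linarith

/-- `K̃_a ⊆ [-Ñ, Ñ]^d` for `Ñ = ⌊N/W⌋ + 2` when `K ⊆ [-N, N]^d` and `a ∈ {0, …, W-1}^d`.
[cite: GreenTao2010, §5] -/
theorem wTrickBody_subset_realBox {W : ℕ} (hW : 1 ≤ W) {a : Fin d → ℕ} (ha : ∀ j, a j < W)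
    {N : ℕ} {K : Set (Fin d → ℝ)} (hK : K ⊆ realBox d N) :
    wTrickBody W a K ⊆ realBox d ((N / W + 2 : ℕ) : ℝ) := by
  intro x hx
  have h := hK hx
  simp only [realBox, Set.mem_Icc, Pi.le_def] at h
  have hWr : (0 : ℝ) < W := by exact_mod_cast hW
  have hÑ := div_add_one_le_wScale hW N
  simp only [realBox, Set.mem_Icc, Pi.le_def]
  constructor <;> intro j
  · have h1 := h.1 j
    have haj : (a j : ℝ) ≤ W := by exact_mod_cast (ha j).le
    have h2 : -((N : ℝ) / W + 1) ≤ x j := by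
      have h3 : -((N : ℝ) + W) ≤ W * x j := by linarith
      have h4 : -((N : ℝ) / W + 1) * W = -((N : ℝ) + W) := by field_simp
      by_contra hcon
      push Not at hcon
      have h5 : x j * W < -((N : ℝ) / W + 1) * W := mul_lt_mul_of_pos_right hcon hWr
      rw [h4] at h5
      linarith
    linarith
  · have h1 := h.2 j
    have haj : (0 : ℝ) ≤ a j := Nat.cast_nonneg _
    have h2 : x j ≤ (N : ℝ) / W := by
      rw [le_div_iff₀ hWr]
      nlinarith
    linarith

/-- `vol(K̃_a) = W^{-d} vol(K)` ("a simple volume-packing argument":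
`#{n : Wn + a ∈ K} = W^{-d} vol_d(K) + o((N/W)^d)` rests on this scaling).
[cite: GreenTao2010, §5 (display before (5.7))] -/
theorem volume_wTrickBody {W : ℕ} (hW : 1 ≤ W) (a : Fin d → ℕ) (K : Set (Fin d → ℝ)) :
    volume (wTrickBody W a K) = ENNReal.ofReal (((W : ℝ) ^ d)⁻¹) * volume K := by
  have hset : wTrickBody W a K =
      (fun x : Fin d → ℝ => (W : ℝ) • x) ⁻¹' ((fun y => (fun j => (a j : ℝ)) + y) ⁻¹' K) := by
    ext x
    simp only [wTrickBody, Set.mem_setOf_eq, Set.mem_preimage]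
    have : ((fun j => (a j : ℝ)) + (W : ℝ) • x) = fun j => (W : ℝ) * x j + (a j : ℝ) := by
      funext j
      simp [add_comm]
    rw [this]
  have hW0 : (W : ℝ) ≠ 0 := by positivity
  rw [hset, Measure.addHaar_preimage_smul volume hW0, measure_preimage_add]
  congr 2
  rw [Module.finrank_fin_fun, abs_of_nonneg (by positivity)]

/-- `vol(K̃_a)` as a real number. [cite: GreenTao2010, §5] -/
theorem volume_wTrickBody_toReal {W : ℕ} (hW : 1 ≤ W) (a : Fin d → ℕ) (K : Set (Fin d → ℝ)) :
    (volume (wTrickBody W a K)).toReal = (volume K).toReal / (W : ℝ) ^ d := by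
  rw [volume_wTrickBody hW, ENNReal.toReal_mul, ENNReal.toReal_ofReal (by positivity)]
  ring

/-- `bᵢ(a) ∈ [W]`: the representative in `{1, …, W}` of `ψ(a) mod W` ("`bᵢ(a)` is simply the
remainder formed when dividing `ψᵢ(a)` by `W`"; we take the representative in `[W]` so that the
case `W = 1` is covered). [cite: GreenTao2010, §5 (Proof of the Main Theorem assuming
Theorem 5.1)] -/
def wTrickResidue (ψ : AffLinForm d) (W : ℕ) (a : Fin d → ℕ) : ℤ :=
  (ψ.eval (fun j => (a j : ℤ)) - 1) % (W : ℤ) + 1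

/-- `ψ̃_a`: "a translate of `ψ` whose constant term is `O(N/W)`", defined by
`ψ(W n + a) = W ψ̃_a(n) + b(a)`: same linear part, constant `⌊(ψ(a) - 1)/W⌋`.
[cite: GreenTao2010, §5 (Proof of the Main Theorem assuming Theorem 5.1)] -/
def AffLinForm.wTrickShift (ψ : AffLinForm d) (W : ℕ) (a : Fin d → ℕ) : AffLinForm d :=
  ⟨ψ.coeff, (ψ.eval (fun j => (a j : ℤ)) - 1) / (W : ℤ)⟩

/-- The linear part of `ψ̃_a` is that of `ψ`. [folklore] -/
@[simp] theorem AffLinForm.wTrickShift_coeff (ψ : AffLinForm d) (W : ℕ) (a : Fin d → ℕ) :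
    (ψ.wTrickShift W a).coeff = ψ.coeff := rfl

/-- `ψ(a) = W ψ̃_a(0) + b(a)`. [cite: GreenTao2010, §5] -/
theorem eval_residue_decomp (ψ : AffLinForm d) (W : ℕ) (a : Fin d → ℕ) :
    ψ.eval (fun j => (a j : ℤ)) = (W : ℤ) * (ψ.wTrickShift W a).const + wTrickResidue ψ W a := by
  have := Int.mul_ediv_add_emod (ψ.eval (fun j => (a j : ℤ)) - 1) (W : ℤ)
  simp only [AffLinForm.wTrickShift, wTrickResidue]
  linarith

/-- **`ψ(W n + a) = W ψ̃_a(n) + b(a)`**. [cite: GreenTao2010, §5 (Proof of the Main Theorem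
assuming Theorem 5.1)] -/
theorem eval_wTrick (ψ : AffLinForm d) (W : ℕ) (a : Fin d → ℕ) (m : Fin d → ℤ) :
    ψ.eval (fun j => (W : ℤ) * m j + (a j : ℤ)) =
      (W : ℤ) * (ψ.wTrickShift W a).eval m + wTrickResidue ψ W a := by
  have h := eval_residue_decomp ψ W a
  simp only [AffLinForm.eval, AffLinForm.wTrickShift] at h ⊢
  have hsum : ∑ j, ψ.coeff j * ((W : ℤ) * m j + (a j : ℤ)) =
      (W : ℤ) * ∑ j, ψ.coeff j * m j + ∑ j, ψ.coeff j * (a j : ℤ) := by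
    rw [Finset.mul_sum, ← Finset.sum_add_distrib]
    exact Finset.sum_congr rfl fun j _ => by ring
  rw [hsum]
  linear_combination h

/-- The real extensions satisfy the same identity: `ψ(W x + a) = W ψ̃_a(x) + b(a)`.
[cite: GreenTao2010, §5] -/
theorem realEval_wTrick (ψ : AffLinForm d) (W : ℕ) (a : Fin d → ℕ) (x : Fin d → ℝ) :
    ψ.realEval (fun j => (W : ℝ) * x j + (a j : ℝ)) =
      (W : ℝ) * (ψ.wTrickShift W a).realEval x + (wTrickResidue ψ W a : ℝ) := by
  have h := eval_residue_decomp ψ W a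
  have hr : ((ψ.eval (fun j => (a j : ℤ)) : ℤ) : ℝ) =
      (W : ℝ) * ((ψ.wTrickShift W a).const : ℝ) + (wTrickResidue ψ W a : ℝ) := by
    exact_mod_cast h
  simp only [AffLinForm.eval, Int.cast_add, Int.cast_sum, Int.cast_mul, Int.cast_natCast] at hr
  simp only [AffLinForm.realEval, AffLinForm.wTrickShift_coeff]
  have hsum : ∑ j, (ψ.coeff j : ℝ) * ((W : ℝ) * x j + (a j : ℝ)) =
      (W : ℝ) * ∑ j, (ψ.coeff j : ℝ) * x j + ∑ j, (ψ.coeff j : ℝ) * (a j : ℝ) := by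
    rw [Finset.mul_sum, ← Finset.sum_add_distrib]
    exact Finset.sum_congr rfl fun j _ => by ring
  rw [hsum]
  linear_combination hr

/-- `1 ≤ b(a) ≤ W`. [cite: GreenTao2010, §5 ("`bᵢ(a)` lies in `[W]`")] -/
theorem wTrickResidue_mem {W : ℕ} (hW : 1 ≤ W) (ψ : AffLinForm d) (a : Fin d → ℕ) :
    1 ≤ wTrickResidue ψ W a ∧ wTrickResidue ψ W a ≤ W := by
  have hW0 : (W : ℤ) ≠ 0 := by exact_mod_cast (by omega : W ≠ 0)
  have hWp : (0 : ℤ) < W := by exact_mod_cast hW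
  have h1 := Int.emod_nonneg (ψ.eval (fun j => (a j : ℤ)) - 1) hW0
  have h2 := Int.emod_lt_of_pos (ψ.eval (fun j => (a j : ℤ)) - 1) hWp
  unfold wTrickResidue
  constructor <;> omega

/-- `gcd(b(a), W) = gcd(ψ(a), W)` (`b(a) ≡ ψ(a) (mod W)`). [cite: GreenTao2010, §5 ("`bᵢ(a)` …
is coprime to `W`" for `a ∈ A`)] -/
theorem gcd_wTrickResidue (ψ : AffLinForm d) (W : ℕ) (a : Fin d → ℕ) :
    Int.gcd (wTrickResidue ψ W a) W = Int.gcd (ψ.eval fun j => (a j : ℤ)) W := by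
  have h := eval_residue_decomp ψ W a
  have hb : wTrickResidue ψ W a =
      ψ.eval (fun j => (a j : ℤ)) + (W : ℤ) * (-(ψ.wTrickShift W a).const) := by linear_combination -h
  rw [← Int.gcd_emod (wTrickResidue ψ W a), hb, Int.add_mul_emod_self_left, Int.gcd_emod]

/-- `ψ(W m + a) ≡ ψ(a) (mod W)`, hence `gcd(ψ(Wm + a), W) = gcd(ψ(a), W)`. [folklore] -/
theorem gcd_eval_wTrick (ψ : AffLinForm d) (W : ℕ) (a : Fin d → ℕ) (m : Fin d → ℤ) :
    Int.gcd (ψ.eval fun j => (W : ℤ) * m j + (a j : ℤ)) W = Int.gcd (ψ.eval fun j => (a j : ℤ)) W := by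
  rw [← gcd_wTrickResidue ψ W a, ← Int.gcd_emod (ψ.eval fun j => (W : ℤ) * m j + (a j : ℤ)),
    eval_wTrick, add_comm, Int.add_mul_emod_self_left, Int.gcd_emod]

/-- `ψ̃_a` has the same linear part as `ψ`, so a system in `s`-normal form stays in `s`-normal
form. [cite: GreenTao2010, §5] -/
theorem IsNormalForm.wTrickShift {s : ℕ} {Ψ : Fin t → AffLinForm d} (h : IsNormalForm s Ψ)
    (W : ℕ) (a : Fin d → ℕ) : IsNormalForm s fun i => (Ψ i).wTrickShift W a :=
  h

/-- … and keeps the standing hypotheses (non-constant forms; no two forms rational multiples of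
each other, via finite complexity of the normal form). [cite: GreenTao2010, §5] -/
theorem isNondegenerateSystem_wTrickShift {s : ℕ} {Ψ : Fin t → AffLinForm d}
    (hΨ : IsNondegenerateSystem Ψ) (hnf : IsNormalForm s Ψ) (W : ℕ) (a : Fin d → ℕ) :
    IsNondegenerateSystem fun i => (Ψ i).wTrickShift W a :=
  IsFiniteComplexitySystem.isNondegenerateSystem
    (Ψ := fun i => (Ψ i).wTrickShift W a) (hnf.wTrickShift W a).isFiniteComplexitySystem
    fun i => hΨ.1 i

/-- `|⌊x/W⌋| ≤ |x|/W + 1`. [folklore] -/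
theorem abs_ediv_le {W : ℕ} (hW : 1 ≤ W) (x : ℤ) : |((x / (W : ℤ) : ℤ) : ℝ)| ≤ |(x : ℝ)| / W + 1 := by
  have hWp : (0 : ℤ) < W := by exact_mod_cast hW
  have hWr : (0 : ℝ) < W := by exact_mod_cast hW
  have h1 := Int.mul_ediv_add_emod x (W : ℤ)
  have h2 := Int.emod_nonneg x hWp.ne'
  have h3 := Int.emod_lt_of_pos x hWp
  set q := x / (W : ℤ)
  set r := x % (W : ℤ)
  have hq : (q : ℝ) = ((x : ℝ) - r) / W := by
    rw [eq_div_iff hWr.ne']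
    have : ((W : ℤ) * q + r : ℤ) = x := h1
    have h' : (W : ℝ) * q + r = x := by exact_mod_cast this
    linarith
  have hr0 : (0 : ℝ) ≤ r := by exact_mod_cast h2
  have hrW : (r : ℝ) < W := by exact_mod_cast h3
  rw [hq, abs_div, abs_of_pos hWr, div_add_one hWr.ne', div_le_div_iff_of_pos_right hWr]
  calc |(x : ℝ) - r| ≤ |(x : ℝ)| + |(r : ℝ)| := abs_sub _ _
    _ ≤ |(x : ℝ)| + W := by rw [abs_of_nonneg hr0]; linarith

/-- **`‖Ψ̃_a‖_Ñ = O(1)`**: if `‖Ψ‖_N ≤ L`, `a ∈ {0, …, W-1}^d` and `Ñ ≥ max(1, N/W)`, then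
`‖Ψ̃_a‖_Ñ ≤ L + t (2L + 2)` (the linear parts are unchanged and
`|ψ̃_{i,a}(0)| ≤ (|ψᵢ(a)| + 1)/W + 1 ≤ L + 2 + L N/W`). [cite: GreenTao2010, §5 ("note that
`‖Ψ̃‖_Ñ = O(1)`")] -/
theorem affLinSize_wTrickShift_le {Ψ : Fin t → AffLinForm d} {N L W : ℕ} (hN : 1 ≤ N) (hW : 1 ≤ W)
    (hL : affLinSize Ψ N ≤ L) {a : Fin d → ℕ} (ha : ∀ j, a j < W) {Ñ : ℝ} (hÑ1 : 1 ≤ Ñ)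
    (hÑ : (N : ℝ) / W ≤ Ñ) :
    affLinSize (fun i => (Ψ i).wTrickShift W a) Ñ ≤ ((L + t * (2 * L + 2) : ℕ) : ℝ) := by
  have hNr : (0 : ℝ) < N := by exact_mod_cast hN
  have hWr : (0 : ℝ) < W := by exact_mod_cast hW
  have hW1r : (1 : ℝ) ≤ W := by exact_mod_cast hW
  have hÑ0 : 0 < Ñ := by linarith
  -- the two parts of `‖Ψ‖_N ≤ L`
  have hcoefsum : ∑ i, ∑ j, |((Ψ i).coeff j : ℝ)| ≤ L :=
    le_trans (le_add_of_nonneg_right (Finset.sum_nonneg fun _ _ => abs_nonneg _)) hL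
  have hconst : ∀ i, |((Ψ i).const : ℝ)| ≤ L * N := by
    intro i
    have ha : |((Ψ i).const : ℝ) / N| ≤ ∑ i', |((Ψ i').const : ℝ) / N| :=
      Finset.single_le_sum (f := fun i' => |((Ψ i').const : ℝ) / N|) (fun _ _ => abs_nonneg _)
        (Finset.mem_univ i)
    have hb : ∑ i', |((Ψ i').const : ℝ) / N| ≤ affLinSize Ψ N :=
      le_add_of_nonneg_left (Finset.sum_nonneg fun _ _ => Finset.sum_nonneg fun _ _ => abs_nonneg _)
    have : |((Ψ i).const : ℝ) / N| ≤ L := by linarith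
    rwa [abs_div, abs_of_pos hNr, div_le_iff₀ hNr] at this
  have hcoefi : ∀ i, ∑ j, |((Ψ i).coeff j : ℝ)| ≤ L := fun i =>
    le_trans (Finset.single_le_sum (f := fun i' => ∑ j, |((Ψ i').coeff j : ℝ)|)
      (fun _ _ => Finset.sum_nonneg fun _ _ => abs_nonneg _) (Finset.mem_univ i)) hcoefsum
  -- `|ψᵢ(a)| ≤ L W + L N`
  have heval : ∀ i, |(((Ψ i).eval fun j => (a j : ℤ)) : ℝ)| ≤ L * W + L * N := by
    intro i
    have h1 : (((Ψ i).eval fun j => (a j : ℤ)) : ℝ) = ∑ j, ((Ψ i).coeff j : ℝ) * (a j : ℝ) + (Ψ i).const := by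
      simp [AffLinForm.eval]
    rw [h1]
    have h2 : |∑ j, ((Ψ i).coeff j : ℝ) * (a j : ℝ)| ≤ L * W := by
      calc |∑ j, ((Ψ i).coeff j : ℝ) * (a j : ℝ)| ≤ ∑ j, |((Ψ i).coeff j : ℝ) * (a j : ℝ)| :=
            Finset.abs_sum_le_sum_abs _ _
        _ ≤ ∑ j, |((Ψ i).coeff j : ℝ)| * W := Finset.sum_le_sum fun j _ => by
            rw [abs_mul, Nat.abs_cast]
            exact mul_le_mul_of_nonneg_left (by exact_mod_cast (ha j).le) (abs_nonneg _)
        _ = (∑ j, |((Ψ i).coeff j : ℝ)|) * W := (Finset.sum_mul _ _ _).symm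
        _ ≤ L * W := mul_le_mul_of_nonneg_right (hcoefi i) hWr.le
    calc |∑ j, ((Ψ i).coeff j : ℝ) * (a j : ℝ) + ((Ψ i).const : ℝ)|
        ≤ |∑ j, ((Ψ i).coeff j : ℝ) * (a j : ℝ)| + |((Ψ i).const : ℝ)| := abs_add_le _ _
      _ ≤ L * W + L * N := add_le_add h2 (hconst i)
  -- the constant terms of `Ψ̃_a`
  have hc : ∀ i, |(((Ψ i).wTrickShift W a).const : ℝ)| / Ñ ≤ 2 * L + 2 := by
    intro i
    have h1 := abs_ediv_le hW ((Ψ i).eval (fun j => (a j : ℤ)) - 1)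
    have h2 : |((((Ψ i).eval fun j => (a j : ℤ)) - 1 : ℤ) : ℝ)| ≤ L * W + L * N + 1 := by
      push_cast
      calc |(((Ψ i).eval fun j => (a j : ℤ)) : ℝ) - 1| ≤ |(((Ψ i).eval fun j => (a j : ℤ)) : ℝ)| + |(1 : ℝ)| :=
            abs_sub _ _
        _ ≤ L * W + L * N + 1 := by rw [abs_one]; linarith [heval i]
    have h3 : |(((Ψ i).wTrickShift W a).const : ℝ)| ≤ L + 2 + L * (N / W) := by
      show |((((Ψ i).eval (fun j => (a j : ℤ)) - 1) / (W : ℤ) : ℤ) : ℝ)| ≤ _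
      refine h1.trans ?_
      rw [div_add_one hWr.ne', div_le_iff₀ hWr]
      have : (L + 2 + L * (N / W)) * (W : ℝ) = L * W + 2 * W + L * N := by
        field_simp
      rw [this]
      linarith
    rw [div_le_iff₀ hÑ0]
    have h4 : L * ((N : ℝ) / W) ≤ L * Ñ := mul_le_mul_of_nonneg_left hÑ (Nat.cast_nonneg L)
    have h5 : (L : ℝ) + 2 ≤ (L + 2) * Ñ := by nlinarith
    linarith
  unfold affLinSize
  simp only [AffLinForm.wTrickShift_coeff]
  push_cast
  have hsum : ∑ i, |(((Ψ i).wTrickShift W a).const : ℝ) / Ñ| ≤ t * (2 * L + 2) := by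
    calc ∑ i, |(((Ψ i).wTrickShift W a).const : ℝ) / Ñ| = ∑ i, |(((Ψ i).wTrickShift W a).const : ℝ)| / Ñ :=
          Finset.sum_congr rfl fun i _ => by rw [abs_div, abs_of_pos hÑ0]
      _ ≤ ∑ _i : Fin t, (2 * (L : ℝ) + 2) := Finset.sum_le_sum fun i _ => hc i
      _ = t * (2 * L + 2) := by rw [Finset.sum_const, Finset.card_univ, Fintype.card_fin, nsmul_eq_mul]
  linarith

/-! ### The expansion `n = W m + a` -/

/-- Integer points of `[-N, N]` divided by `W ≥ 1` land in `[-(⌊N/W⌋ + 2), ⌊N/W⌋ + 2]`.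
[folklore] -/
theorem abs_ediv_le_wScale {W : ℕ} (hW : 1 ≤ W) {N : ℕ} {n : ℤ} (hn : -(N : ℤ) ≤ n ∧ n ≤ N) :
    -((N / W + 2 : ℕ) : ℤ) ≤ n / (W : ℤ) ∧ n / (W : ℤ) ≤ ((N / W + 2 : ℕ) : ℤ) := by
  have hWp : (0 : ℤ) < W := by exact_mod_cast hW
  have h1 := Int.mul_ediv_add_emod n (W : ℤ)
  have h2 := Int.emod_nonneg n hWp.ne'
  have h3 := Int.emod_lt_of_pos n hWp
  have h4 : ((W : ℕ) : ℤ) * ((N / W : ℕ) : ℤ) + ((N % W : ℕ) : ℤ) = N := by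
    exact_mod_cast Nat.div_add_mod N W
  have h5 : ((N % W : ℕ) : ℤ) < W := by exact_mod_cast Nat.mod_lt N hW
  have h6 : (0 : ℤ) ≤ ((N % W : ℕ) : ℤ) := by positivity
  set q := n / (W : ℤ) with hq
  set r := n % (W : ℤ) with hr
  push_cast
  constructor
  · by_contra hcon
    push Not at hcon
    have h7 : q ≤ -((N / W : ℕ) : ℤ) - 3 := by omega
    have h8 : (W : ℤ) * q ≤ (W : ℤ) * (-((N / W : ℕ) : ℤ) - 3) := mul_le_mul_of_nonneg_left h7 hWp.le
    nlinarith
  · by_contra hcon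
    push Not at hcon
    have h7 : ((N / W : ℕ) : ℤ) + 1 ≤ q := by omega
    have h8 : (W : ℤ) * (((N / W : ℕ) : ℤ) + 1) ≤ (W : ℤ) * q := mul_le_mul_of_nonneg_left h7 hWp.le
    nlinarith

open Classical in
/-- **"By a simple expansion"** (5.5): a sum over `K ∩ ℤ^d`, `K ⊆ [-N,N]^d`, splits along the
residues `a ∈ {0, …, W-1}^d`, `n = W m + a`, the inner sum running over
`m ∈ K̃_a ∩ ℤ^d ⊆ [-Ñ, Ñ]^d`, `Ñ = ⌊N/W⌋ + 2`. [cite: GreenTao2010, §5 ((5.5))] -/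
theorem sum_filter_latticeBox_eq_sum_residues {M : Type*} [AddCommMonoid M] {W : ℕ} (hW : 1 ≤ W)
    {N : ℕ} {K : Set (Fin d → ℝ)} (hK : K ⊆ realBox d N) (F : (Fin d → ℤ) → M) :
    ∑ n ∈ (latticeBox d N).filter (fun n => realPoint n ∈ K), F n =
      ∑ a ∈ Fintype.piFinset (fun _ : Fin d => Finset.range W),
        ∑ m ∈ (latticeBox d (N / W + 2)).filter (fun m => realPoint m ∈ wTrickBody W a K),
          F (fun j => (W : ℤ) * m j + (a j : ℤ)) := by
  classical
  have hWp : (0 : ℤ) < W := by exact_mod_cast hW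
  set S := Fintype.piFinset (fun _ : Fin d => Finset.range W) with hS
  set T := latticeBox d (N / W + 2) with hT
  -- reshape the right-hand side as a sum over a filtered product
  have hrhs : ∑ a ∈ S, ∑ m ∈ T.filter (fun m => realPoint m ∈ wTrickBody W a K),
      F (fun j => (W : ℤ) * m j + (a j : ℤ)) =
      ∑ am ∈ (S ×ˢ T).filter (fun am => realPoint am.2 ∈ wTrickBody W am.1 K),
        F (fun j => (W : ℤ) * am.2 j + (am.1 j : ℤ)) := by
    rw [Finset.sum_filter, Finset.sum_product]
    refine Finset.sum_congr rfl fun a _ => ?_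
    rw [Finset.sum_filter]
  rw [hrhs]
  -- the bijection `n ↦ (n mod W, ⌊n/W⌋)`
  have hreal : ∀ (a : Fin d → ℕ) (m : Fin d → ℤ),
      (fun j => (W : ℝ) * realPoint m j + (a j : ℝ)) = realPoint fun j => (W : ℤ) * m j + (a j : ℤ) := by
    intro a m
    funext j
    simp [realPoint]
  refine Finset.sum_nbij' (fun n => (fun j => (n j % (W : ℤ)).toNat, fun j => n j / (W : ℤ)))
    (fun am => fun j => (W : ℤ) * am.2 j + (am.1 j : ℤ)) ?_ ?_ ?_ ?_ ?_
  · -- into the target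
    intro n hn
    obtain ⟨hnbox, hnK⟩ := Finset.mem_filter.mp (Finset.mem_coe.mp hn)
    have hnj : ∀ j, -(N : ℤ) ≤ n j ∧ n j ≤ N := fun j =>
      Finset.mem_Icc.mp (Fintype.mem_piFinset.mp hnbox j)
    have hdecomp : (fun j => (W : ℤ) * (n j / (W : ℤ)) + (((n j % (W : ℤ)).toNat : ℕ) : ℤ)) = n := by
      funext j
      rw [Int.toNat_of_nonneg (Int.emod_nonneg _ hWp.ne')]
      exact Int.mul_ediv_add_emod (n j) W
    refine Finset.mem_coe.mpr (Finset.mem_filter.mpr ⟨Finset.mem_product.mpr ⟨?_, ?_⟩, ?_⟩)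
    · refine Fintype.mem_piFinset.mpr fun j => Finset.mem_range.mpr ?_
      have h1 := Int.emod_lt_of_pos (n j) hWp
      have h2 := Int.emod_nonneg (n j) hWp.ne'
      show (n j % (W : ℤ)).toNat < W
      omega
    · exact Fintype.mem_piFinset.mpr fun j => Finset.mem_Icc.mpr (abs_ediv_le_wScale hW (hnj j))
    · show realPoint (fun j => n j / (W : ℤ)) ∈ wTrickBody W (fun j => (n j % (W : ℤ)).toNat) K
      rw [mem_wTrickBody, hreal, hdecomp]
      exact hnK
  · -- the inverse maps into the source
    intro am ham
    obtain ⟨hST, hmK⟩ := Finset.mem_filter.mp (Finset.mem_coe.mp ham)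
    obtain ⟨haS, hmT⟩ := Finset.mem_product.mp hST
    rw [mem_wTrickBody, hreal] at hmK
    refine Finset.mem_coe.mpr (Finset.mem_filter.mpr ⟨?_, hmK⟩)
    have hbox := hK hmK
    simp only [realBox, Set.mem_Icc, Pi.le_def, realPoint] at hbox
    refine Fintype.mem_piFinset.mpr fun j => Finset.mem_Icc.mpr ⟨?_, ?_⟩
    · exact_mod_cast hbox.1 j
    · exact_mod_cast hbox.2 j
  · -- left inverse
    intro n _
    funext j
    simp only
    rw [Int.toNat_of_nonneg (Int.emod_nonneg _ hWp.ne')]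
    exact Int.mul_ediv_add_emod (n j) W
  · -- right inverse
    intro am ham
    obtain ⟨hST, -⟩ := Finset.mem_filter.mp (Finset.mem_coe.mp ham)
    obtain ⟨haS, -⟩ := Finset.mem_product.mp hST
    have ha : ∀ j, (0 : ℤ) ≤ (am.1 j : ℤ) ∧ (am.1 j : ℤ) < W := fun j =>
      ⟨by positivity, by exact_mod_cast Finset.mem_range.mp (Fintype.mem_piFinset.mp haS j)⟩
    refine Prod.ext (funext fun j => ?_) (funext fun j => ?_)
    · simp only
      rw [add_comm, Int.add_mul_emod_self_left, Int.emod_eq_of_lt (ha j).1 (ha j).2, Int.toNat_natCast]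
    · simp only
      rw [add_comm, Int.add_mul_ediv_left _ _ hWp.ne', Int.ediv_eq_zero_of_lt (ha j).1 (ha j).2,
        zero_add]
  · intro n _
    congr 1
    funext j
    simp only
    rw [Int.toNat_of_nonneg (Int.emod_nonneg _ hWp.ne')]
    exact (Int.mul_ediv_add_emod (n j) W).symm

/-! ### The residues `a ∈ A` and the local factor `β_W` -/

/-- The product of local von Mangoldt functions is `(W/φ(W))ᵗ` on `A` and `0` off `A`
(from (1.5)). [cite: GreenTao2010, (1.5)–(1.6)] -/
theorem prod_localVonMangoldt_eq (Ψ : Fin t → AffLinForm d) (W : ℕ) (n : Fin d → ℤ) :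
    ∏ i, localVonMangoldt W ((Ψ i).eval n) =
      if ∀ i, Int.gcd ((Ψ i).eval n) W = 1 then ((W : ℝ) / Nat.totient W) ^ t else 0 := by
  split_ifs with h
  · rw [Finset.prod_congr rfl fun i _ => show localVonMangoldt W ((Ψ i).eval n) =
      (W : ℝ) / Nat.totient W by rw [localVonMangoldt, if_pos (h i)]]
    rw [Finset.prod_const, Finset.card_univ, Fintype.card_fin]
  · push Not at h
    obtain ⟨i, hi⟩ := h
    exact Finset.prod_eq_zero (Finset.mem_univ i) (by rw [localVonMangoldt, if_neg hi])

open Classical in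
/-- **`β_W = (W/φ(W))ᵗ |A| / W^d`** with `A = {a ∈ [W]^d : gcd(ψᵢ(a), W) = 1 for all i}`
("from (1.6) we have `β_W = (W/φ(W))ᵗ |A|/W^d`"; residues taken in `{0, …, W-1}^d`).
[cite: GreenTao2010, §5 (Proof of the Main Theorem assuming Theorem 5.1)] -/
theorem localFactor_eq_card_coprimeResidues (Ψ : Fin t → AffLinForm d) (W : ℕ) :
    localFactor Ψ W = ((W : ℝ) ^ d)⁻¹ * (((W : ℝ) / Nat.totient W) ^ t *
      #((Fintype.piFinset fun _ : Fin d => Finset.range W).filter fun a =>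
        ∀ i, Int.gcd ((Ψ i).eval fun j => (a j : ℤ)) W = 1)) := by
  unfold localFactor
  congr 1
  simp_rw [prod_localVonMangoldt_eq]
  rw [← Finset.sum_filter, Finset.sum_const, nsmul_eq_mul, mul_comm]

/-- **Off `A` the summand vanishes**: if `gcd(ψᵢ(a), W) ≠ 1` for some `i` and
`ψᵢ(W m + a) > W`, then `∏ᵢ Λ'(ψᵢ(W m + a)) = 0` ("`ψᵢ(W n + a)` will not be coprime to `W` …
and `W` is so small compared to `N`, we see that `Λ'(ψᵢ(Wn + a)) = 0`").
[cite: GreenTao2010, §5 (Proof of the Main Theorem assuming Theorem 5.1)] -/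
theorem prod_vonMangoldtPrime_wTrick_eq_zero {Ψ : Fin t → AffLinForm d} {W : ℕ} (hW : 1 ≤ W)
    {a : Fin d → ℕ} (ha : ¬ ∀ i, Int.gcd ((Ψ i).eval fun j => (a j : ℤ)) W = 1) {m : Fin d → ℤ}
    (hm : ∀ i, (W : ℤ) < (Ψ i).eval fun j => (W : ℤ) * m j + (a j : ℤ)) :
    ∏ i, vonMangoldtPrime ((Ψ i).eval fun j => (W : ℤ) * m j + (a j : ℤ)).toNat = 0 := by
  push Not at ha
  obtain ⟨i, hi⟩ := ha
  refine Finset.prod_eq_zero (Finset.mem_univ i) (vonMangoldtPrime_of_not_prime fun hp => hi ?_)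
  set v := (Ψ i).eval fun j => (W : ℤ) * m j + (a j : ℤ) with hv
  have hv0 : 0 ≤ v := le_of_lt (lt_of_le_of_lt (Int.natCast_nonneg W) (hm i))
  have hvnat : ((v.toNat : ℕ) : ℤ) = v := Int.toNat_of_nonneg hv0
  rw [← gcd_eval_wTrick (Ψ i) W a m, ← hv, ← hvnat, Int.gcd_natCast_natCast]
  -- a prime `> W` is coprime to `W`
  refine (Nat.Prime.coprime_iff_not_dvd hp).mpr fun hdvd => ?_
  have h1 : v.toNat ≤ W := Nat.le_of_dvd (by omega) hdvd
  have h2 : (W : ℤ) < v := hm i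
  omega

/-- **On `A`**: `Λ'(ψᵢ(W m + a)) = (W/φ(W)) Λ'_{bᵢ(a),W}(ψ̃_{i,a}(m))` for every `i` (when
`ψ̃_{i,a}(m) ≥ 0`), hence `∏ᵢ Λ'(ψᵢ(W m + a)) = (W/φ(W))ᵗ ∏ᵢ Λ'_{bᵢ(a),W}(ψ̃_{i,a}(m))` ((5.6)).
[cite: GreenTao2010, §5 ((5.6))] -/
theorem prod_vonMangoldtPrime_wTrick_eq {Ψ : Fin t → AffLinForm d} {W : ℕ} (hW : 1 ≤ W)
    (a : Fin d → ℕ) {m : Fin d → ℤ} (hm : ∀ i, 0 ≤ ((Ψ i).wTrickShift W a).eval m) :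
    ∏ i, vonMangoldtPrime ((Ψ i).eval fun j => (W : ℤ) * m j + (a j : ℤ)).toNat =
      ((W : ℝ) / Nat.totient W) ^ t *
        ∏ i, vonMangoldtW W (wTrickResidue (Ψ i) W a).toNat
          (((Ψ i).wTrickShift W a).eval m).toNat := by
  have hφ : (0 : ℝ) < Nat.totient W := by exact_mod_cast Nat.totient_pos.mpr (by omega)
  have hWr : (0 : ℝ) < W := by exact_mod_cast hW
  have hdist : ((W : ℝ) / Nat.totient W) ^ t *
      ∏ i, vonMangoldtW W (wTrickResidue (Ψ i) W a).toNat (((Ψ i).wTrickShift W a).eval m).toNat =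
      ∏ i, ((W : ℝ) / Nat.totient W *
        vonMangoldtW W (wTrickResidue (Ψ i) W a).toNat (((Ψ i).wTrickShift W a).eval m).toNat) := by
    rw [Finset.prod_mul_distrib, Finset.prod_const, Finset.card_univ, Fintype.card_fin]
  rw [hdist]
  refine Finset.prod_congr rfl fun i _ => ?_
  have hb := (wTrickResidue_mem hW (Ψ i) a).1
  have h1 := eval_wTrick (Ψ i) W a m
  have h4 : 0 ≤ (Ψ i).eval fun j => (W : ℤ) * m j + (a j : ℤ) := by
    rw [h1]
    exact add_nonneg (mul_nonneg (Int.natCast_nonneg W) (hm i)) (le_trans zero_le_one hb)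
  have hnat : ((Ψ i).eval fun j => (W : ℤ) * m j + (a j : ℤ)).toNat =
      W * (((Ψ i).wTrickShift W a).eval m).toNat + (wTrickResidue (Ψ i) W a).toNat := by
    have h5 : ((((Ψ i).eval fun j => (W : ℤ) * m j + (a j : ℤ)).toNat : ℕ) : ℤ) =
        ((W * (((Ψ i).wTrickShift W a).eval m).toNat + (wTrickResidue (Ψ i) W a).toNat : ℕ) : ℤ) := by
      rw [Int.toNat_of_nonneg h4, h1]
      push_cast
      rw [Int.toNat_of_nonneg (hm i), Int.toNat_of_nonneg (le_trans zero_le_one hb)]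
    exact_mod_cast h5
  rw [hnat, vonMangoldtW, ← mul_assoc, show (W : ℝ) / Nat.totient W * ((Nat.totient W : ℝ) / W) = 1 by
    field_simp, one_mul]

/-- Weighted sums of close quantities are close: `|∑ ρ fₐ - ∑ ρ gₐ| ≤ #s ρ δ`. [folklore] -/
theorem abs_sum_mul_sub_sum_mul_le {ι : Type*} (s : Finset ι) {ρ δ : ℝ} (hρ : 0 ≤ ρ)
    (f g : ι → ℝ) (h : ∀ a ∈ s, |f a - g a| ≤ δ) :
    |∑ a ∈ s, ρ * f a - ∑ a ∈ s, ρ * g a| ≤ #s * (ρ * δ) := by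
  rw [← Finset.sum_sub_distrib]
  calc |∑ a ∈ s, (ρ * f a - ρ * g a)| ≤ ∑ a ∈ s, |ρ * f a - ρ * g a| :=
        Finset.abs_sum_le_sum_abs _ _
    _ ≤ ∑ _a ∈ s, ρ * δ := Finset.sum_le_sum fun a ha => by
        rw [← mul_sub, abs_mul, abs_of_nonneg hρ]
        exact mul_le_mul_of_nonneg_left (h a ha) hρ
    _ = #s * (ρ * δ) := by rw [Finset.sum_const, nsmul_eq_mul]

/-! ### Numerical lemmas -/

/-- `√X + 1 ≤ X^{8/10} + 1` for `X ≥ 1`. [folklore] -/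
theorem natSqrt_le_rpow {X : ℕ} (hX : 1 ≤ X) : (Nat.sqrt X : ℝ) ≤ (X : ℝ) ^ ((8 : ℝ) / 10) := by
  have hX1 : (1 : ℝ) ≤ X := by exact_mod_cast hX
  have h1 : ((Nat.sqrt X : ℕ) : ℝ) ≤ Real.sqrt X := by
    refine (Real.le_sqrt (Nat.cast_nonneg (Nat.sqrt X)) (Nat.cast_nonneg X)).mpr ?_
    have : (Nat.sqrt X) ^ 2 ≤ X := Nat.sqrt_le' X
    exact_mod_cast this
  refine h1.trans ?_
  rw [Real.sqrt_eq_rpow]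
  exact Real.rpow_le_rpow_of_exponent_le hX1 (by norm_num)

/-- `log₂ X + 1 ≤ 2 (1 + log X)` for `X ≥ 1`. [folklore] -/
theorem natLog_two_le {X : ℕ} (hX : 1 ≤ X) : (Nat.log 2 X : ℝ) + 1 ≤ 2 * (1 + Real.log X) := by
  have hX0 : (0 : ℝ) < X := by exact_mod_cast hX
  have h1 : (2 : ℝ) ^ Nat.log 2 X ≤ X := by exact_mod_cast Nat.pow_log_le_self 2 (by omega)
  have h2 : (Nat.log 2 X : ℝ) * Real.log 2 ≤ Real.log X := by
    rw [← Real.log_pow]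
    exact Real.log_le_log (by positivity) h1
  have h3 : (1 : ℝ) / 2 < Real.log 2 := by
    have := Real.log_two_gt_d9
    linarith
  have h4 : 0 ≤ Real.log X := Real.log_nonneg (by exact_mod_cast hX)
  have h5 : (Nat.log 2 X : ℝ) ≤ 2 * Real.log X := by
    have h6 : (Nat.log 2 X : ℝ) * (1 / 2) ≤ (Nat.log 2 X : ℝ) * Real.log 2 :=
      mul_le_mul_of_nonneg_left h3.le (Nat.cast_nonneg _)
    linarith
  linarith

/-- The prime-power error is dominated by the standard crude error shape:
`t (√X + 1)(log₂ X + 1) P log^t X ≤ 2t ((AN)^{8/10} + 1) P (1 + log X)^{t+1}` for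
`X = 2LN ≤ AN`, `X ≥ 1`. [folklore] -/
theorem primePower_error_le {t L N : ℕ} {A P : ℝ} (hN : 1 ≤ N) (hL : 1 ≤ L) (hA : 2 * (L : ℝ) ≤ A)
    (hP : 0 ≤ P) :
    t * (((Nat.sqrt (2 * L * N) + 1) * (Nat.log 2 (2 * L * N) + 1) : ℕ) : ℝ) * P *
        Real.log (2 * L * N) ^ t ≤
      2 * t * ((A * N) ^ ((8 : ℝ) / 10) + 1) * P * (1 + Real.log (2 * L * N)) ^ (t + 1) := by
  set X : ℕ := 2 * L * N with hX
  have hX1 : 1 ≤ X := by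
    rw [hX]
    calc 1 ≤ 2 * 1 * 1 := by norm_num
      _ ≤ 2 * L * N := Nat.mul_le_mul (Nat.mul_le_mul_left 2 hL) hN
  have hXr : ((X : ℕ) : ℝ) = 2 * (L : ℝ) * N := by rw [hX]; push_cast; ring
  have hN0 : (0 : ℝ) ≤ N := Nat.cast_nonneg N
  have hlog0 : 0 ≤ Real.log (2 * L * N) := by
    rw [← hXr]
    exact Real.log_nonneg (by exact_mod_cast hX1)
  have hsqrt : ((Nat.sqrt X : ℕ) : ℝ) + 1 ≤ (A * N) ^ ((8 : ℝ) / 10) + 1 := by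
    have h1 := natSqrt_le_rpow hX1
    have h2 : ((X : ℕ) : ℝ) ^ ((8 : ℝ) / 10) ≤ (A * N) ^ ((8 : ℝ) / 10) := by
      refine Real.rpow_le_rpow (Nat.cast_nonneg _) ?_ (by norm_num)
      rw [hXr]
      exact mul_le_mul_of_nonneg_right hA hN0
    linarith
  have hlog : ((Nat.log 2 X : ℕ) : ℝ) + 1 ≤ 2 * (1 + Real.log (2 * L * N)) := by
    rw [← hXr]
    exact natLog_two_le hX1
  have hcast : (((Nat.sqrt X + 1) * (Nat.log 2 X + 1) : ℕ) : ℝ) =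
      (((Nat.sqrt X : ℕ) : ℝ) + 1) * (((Nat.log 2 X : ℕ) : ℝ) + 1) := by push_cast; ring
  rw [hcast]
  have hsq0 : 0 ≤ ((Nat.sqrt X : ℕ) : ℝ) + 1 := by positivity
  have hlg0 : 0 ≤ ((Nat.log 2 X : ℕ) : ℝ) + 1 := by positivity
  have hprod : (((Nat.sqrt X : ℕ) : ℝ) + 1) * (((Nat.log 2 X : ℕ) : ℝ) + 1) ≤
      ((A * N) ^ ((8 : ℝ) / 10) + 1) * (2 * (1 + Real.log (2 * L * N))) :=
    mul_le_mul hsqrt hlog hlg0 (by linarith)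
  have hpow : Real.log (2 * L * N) ^ t ≤ (1 + Real.log (2 * L * N)) ^ t :=
    pow_le_pow_left₀ hlog0 (by linarith) t
  calc (t : ℝ) * ((((Nat.sqrt X : ℕ) : ℝ) + 1) * (((Nat.log 2 X : ℕ) : ℝ) + 1)) * P *
        Real.log (2 * L * N) ^ t
      ≤ t * (((A * N) ^ ((8 : ℝ) / 10) + 1) * (2 * (1 + Real.log (2 * L * N)))) * P *
          (1 + Real.log (2 * L * N)) ^ t := by
        refine mul_le_mul (mul_le_mul_of_nonneg_right (mul_le_mul_of_nonneg_left hprod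
          (Nat.cast_nonneg t)) hP) hpow (pow_nonneg hlog0 t) ?_
        exact mul_nonneg (mul_nonneg (Nat.cast_nonneg t) (mul_nonneg (by linarith) (by linarith))) hP
    _ = 2 * t * ((A * N) ^ ((8 : ℝ) / 10) + 1) * P * (1 + Real.log (2 * L * N)) ^ (t + 1) := by
        ring

/-- **Positivity at the `W`-tricked scale**: if `N ≥ (4W)^{10}`, `b ≤ W` and
`W y + b > N^{8/10}`, then `y > Ñ^{7/10}` for `Ñ = ⌊N/W⌋ + 2` ("`ψ₁, …, ψ_t > N^{8/10}` on `K`"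
gives "`ψ̃ > Ñ^{7/10}` on `K̃`"). [cite: GreenTao2010, Thm. 4.5 and Thm. 5.1] -/
theorem wScale_rpow_lt {N W : ℕ} (hW : 1 ≤ W) (hN : (4 * W) ^ 10 ≤ N) {y b : ℝ} (hb : b ≤ W)
    (hy : (N : ℝ) ^ ((8 : ℝ) / 10) < W * y + b) :
    ((N / W + 2 : ℕ) : ℝ) ^ ((7 : ℝ) / 10) < y := by
  have hWr : (1 : ℝ) ≤ W := by exact_mod_cast hW
  have hW0 : (0 : ℝ) < W := by linarith
  have hN1nat : 1 ≤ N := le_trans (Nat.one_le_pow _ _ (by omega)) hN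
  have hN1 : (1 : ℝ) ≤ N := by exact_mod_cast hN1nat
  have hN0 : (0 : ℝ) < N := by linarith
  -- `N^{1/10} ≥ 4W`
  have h4W : 4 * (W : ℝ) ≤ (N : ℝ) ^ ((1 : ℝ) / 10) := by
    have h1 : ((4 * W : ℕ) : ℝ) ^ (10 : ℕ) ≤ N := by exact_mod_cast hN
    have h2 : (0 : ℝ) ≤ ((4 * W : ℕ) : ℝ) := Nat.cast_nonneg _
    calc 4 * (W : ℝ) = ((((4 * W : ℕ) : ℝ)) ^ (10 : ℕ)) ^ ((1 : ℝ) / 10) := by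
          rw [← Real.rpow_natCast, ← Real.rpow_mul h2]
          norm_num
      _ ≤ (N : ℝ) ^ ((1 : ℝ) / 10) := Real.rpow_le_rpow (by positivity) h1 (by norm_num)
  -- `Ñ ≤ 3N`, so `Ñ^{7/10} ≤ 3 N^{7/10}`
  have hÑ : ((N / W + 2 : ℕ) : ℝ) ≤ 3 * N := by
    have h1 : ((N / W : ℕ) : ℝ) ≤ N := by exact_mod_cast Nat.div_le_self N W
    push_cast
    linarith
  have hÑ7 : ((N / W + 2 : ℕ) : ℝ) ^ ((7 : ℝ) / 10) ≤ 3 * (N : ℝ) ^ ((7 : ℝ) / 10) := by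
    calc ((N / W + 2 : ℕ) : ℝ) ^ ((7 : ℝ) / 10) ≤ (3 * (N : ℝ)) ^ ((7 : ℝ) / 10) :=
          Real.rpow_le_rpow (Nat.cast_nonneg _) hÑ (by norm_num)
      _ = (3 : ℝ) ^ ((7 : ℝ) / 10) * (N : ℝ) ^ ((7 : ℝ) / 10) := Real.mul_rpow (by norm_num) hN0.le
      _ ≤ 3 * (N : ℝ) ^ ((7 : ℝ) / 10) :=
          mul_le_mul_of_nonneg_right (Real.rpow_le_self_of_one_le (by norm_num) (by norm_num))
            (Real.rpow_nonneg hN0.le _)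
  -- `N^{8/10} = N^{1/10} N^{7/10} ≥ 4 W N^{7/10} ≥ W (3 N^{7/10} + 1)`
  have h7 : (1 : ℝ) ≤ (N : ℝ) ^ ((7 : ℝ) / 10) := Real.one_le_rpow hN1 (by norm_num)
  have h8 : (N : ℝ) ^ ((8 : ℝ) / 10) = (N : ℝ) ^ ((1 : ℝ) / 10) * (N : ℝ) ^ ((7 : ℝ) / 10) := by
    rw [← Real.rpow_add hN0]; norm_num
  have h7' : (2 : ℝ) ≤ (N : ℝ) ^ ((7 : ℝ) / 10) := by
    have hN4 : (4 : ℝ) ≤ N := by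
      have : 4 ≤ N := le_trans (by
        calc 4 ≤ 4 ^ 10 := by norm_num
          _ ≤ (4 * W) ^ 10 := Nat.pow_le_pow_left (by omega) 10) hN
      exact_mod_cast this
    have h2 : (2 : ℝ) = (4 : ℝ) ^ ((1 : ℝ) / 2) := by
      rw [show (4 : ℝ) = (2 : ℝ) ^ (2 : ℕ) by norm_num, ← Real.rpow_natCast,
        ← Real.rpow_mul (by norm_num)]
      norm_num
    calc (2 : ℝ) = (4 : ℝ) ^ ((1 : ℝ) / 2) := h2
      _ ≤ (4 : ℝ) ^ ((7 : ℝ) / 10) := Real.rpow_le_rpow_of_exponent_le (by norm_num) (by norm_num)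
      _ ≤ (N : ℝ) ^ ((7 : ℝ) / 10) := Real.rpow_le_rpow (by norm_num) hN4 (by norm_num)
  have hkey : (W : ℝ) * (3 * (N : ℝ) ^ ((7 : ℝ) / 10) + 1) ≤ (N : ℝ) ^ ((8 : ℝ) / 10) - W := by
    rw [h8]
    have h9 : 4 * (W : ℝ) * (N : ℝ) ^ ((7 : ℝ) / 10) ≤ (N : ℝ) ^ ((1 : ℝ) / 10) * (N : ℝ) ^ ((7 : ℝ) / 10) :=
      mul_le_mul_of_nonneg_right h4W (by linarith)
    have h10 : (W : ℝ) * 2 ≤ (W : ℝ) * (N : ℝ) ^ ((7 : ℝ) / 10) := mul_le_mul_of_nonneg_left h7' hW0.le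
    nlinarith
  -- conclude
  have hy' : (N : ℝ) ^ ((8 : ℝ) / 10) - W < W * y := by linarith
  have hy'' : 3 * (N : ℝ) ^ ((7 : ℝ) / 10) + 1 < y := by
    by_contra hcon
    push Not at hcon
    have := mul_le_mul_of_nonneg_left hcon hW0.le
    linarith
  linarith

/-- `#([-N, N]^d ∩ ℤ^d) = (2N+1)^d`. [folklore] -/
theorem card_latticeBox (d N : ℕ) : #(latticeBox d N) = (2 * N + 1) ^ d := by
  have h1 : ((N : ℤ) + 1 - -(N : ℤ)) = ((2 * N + 1 : ℕ) : ℤ) := by push_cast; ring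
  simp only [latticeBox, Fintype.card_piFinset, Int.card_Icc, Finset.prod_const,
    Finset.card_univ, Fintype.card_fin, h1, Int.toNat_natCast]

/-- `#(K ∩ ℤ^d) ≤ (2N+1)^d ≤ (3N)^d` for `N ≥ 1`. [folklore] -/
theorem latticePointCount_le (K : Set (Fin d → ℝ)) {N : ℕ} (hN : 1 ≤ N) :
    (latticePointCount K N : ℝ) ≤ (3 : ℝ) ^ d * (N : ℝ) ^ d := by
  classical
  have h1 : latticePointCount K N ≤ (2 * N + 1) ^ d := by
    unfold latticePointCount
    exact (Finset.card_filter_le _ _).trans (card_latticeBox d N).le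
  have h2 : (latticePointCount K N : ℝ) ≤ (2 * (N : ℝ) + 1) ^ d := by exact_mod_cast h1
  refine h2.trans ?_
  rw [← mul_pow]
  have h3 : (1 : ℝ) ≤ N := by exact_mod_cast hN
  exact pow_le_pow_left₀ (by positivity) (by linarith) d

/-- The `W`-powers of the main-term comparison are `O_W(N^{d-1})`:
`W^d Ñ^{d-1} + W^d N^{d-1} ≤ 2 (2W)^d N^{d-1}` when `W Ñ ≤ 2N`. [folklore] -/
theorem wpow_scale_le {W Ñ N : ℝ} {d : ℕ} (hd : 1 ≤ d) (hW : 1 ≤ W) (hÑ : 0 ≤ Ñ) (hN : 0 ≤ N)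
    (h : W * Ñ ≤ 2 * N) :
    W ^ d * Ñ ^ (d - 1) + W ^ d * N ^ (d - 1) ≤ 2 * (2 * W) ^ d * N ^ (d - 1) := by
  obtain ⟨k, rfl⟩ : ∃ k, d = k + 1 := ⟨d - 1, by omega⟩
  simp only [Nat.add_sub_cancel]
  have hW0 : 0 ≤ W := by linarith
  have h1 : W ^ (k + 1) * Ñ ^ k = W * (W * Ñ) ^ k := by rw [pow_succ, mul_pow]; ring
  have h2 : (W * Ñ) ^ k ≤ (2 * N) ^ k := pow_le_pow_left₀ (by positivity) h k
  have h3 : W ^ (k + 1) * Ñ ^ k ≤ W * (2 : ℝ) ^ k * N ^ k := by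
    rw [h1, mul_assoc, ← mul_pow]
    exact mul_le_mul_of_nonneg_left h2 hW0
  have hWk : 1 ≤ W ^ k := one_le_pow₀ hW
  have h4 : W * (2 : ℝ) ^ k * N ^ k ≤ (2 * W) ^ (k + 1) * N ^ k := by
    refine mul_le_mul_of_nonneg_right ?_ (by positivity)
    rw [mul_pow, pow_succ, pow_succ]
    -- W 2^k ≤ 2^k 2 (W^k W)
    have : W * (2 : ℝ) ^ k ≤ W * (2 : ℝ) ^ k * (2 * W ^ k) := by
      refine le_mul_of_one_le_right (by positivity) ?_
      nlinarith
    calc W * (2 : ℝ) ^ k ≤ W * (2 : ℝ) ^ k * (2 * W ^ k) := this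
      _ = (2 : ℝ) ^ k * 2 * (W ^ k * W) := by ring
  have h5 : W ^ (k + 1) * N ^ k ≤ (2 * W) ^ (k + 1) * N ^ k := by
    refine mul_le_mul_of_nonneg_right (pow_le_pow_left₀ hW0 (by linarith) _) (by positivity)
  linarith

/-! ### Discharge of `GreenTao2010_mainNormalForm_of_wTricked` -/

set_option maxHeartbeats 400000 in
open Classical in
/-- **§5 of Green–Tao 2010, "Proof of the Main Theorem assuming Theorem 5.1", proved**: for every
`s ≥ 1`, the `W`-tricked statement (conclusion of Thm. 5.1 at level `s`, uniform in the cutoff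
range and in the residues) implies the normal-form statement (conclusion of Thm. 4.5 at level
`s`) — the discharge of the named fact `GreenTao2010_mainNormalForm_of_wTricked`. The proof is
the printed one, see the module docstring: `Λ → Λ'`; `∏_p β_p = β_W + o(1)`;
`β_W = (W/φ(W))ᵗ|A|/W^d`; the expansion `n = Wm + a` with vanishing off `A` and (5.6) on `A`;
Thm. 5.1 for each `a ∈ A` at scale `Ñ = ⌊N/W⌋ + 2`; volume packing for `K̃_a` and `K`.
[cite: GreenTao2010, §5 (Proof of the Main Theorem assuming Theorem 5.1), Lemma 1.3, (1.6),
App. A] -/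
theorem GreenTao2010_mainNormalForm_of_wTricked_holds : GreenTao2010_mainNormalForm_of_wTricked := by
  intro s hs h51 d t L hd ht ε hε
  classical
  -- constants depending on `d, t, L`
  obtain ⟨B, hB0, hB⟩ := singularProductPartial_le_uniform t L
  obtain ⟨Cd, hCd⟩ := GreenTao2010_latticePointsConvexBody_holds d hd
  have hCd0 : 0 ≤ Cd := by
    have h := hCd 1 le_rfl ∅ convex_empty (Set.empty_subset _)
    simp only [Set.mem_empty_iff_false, Finset.filter_false, Finset.card_empty, Nat.cast_zero,
      measure_empty, ENNReal.toReal_zero, sub_self, abs_zero, Nat.cast_one, one_pow, mul_one] at h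
    exact h
  obtain ⟨B₁, hB₁⟩ : ∃ B₁ : ℝ, B₁ = max B 1 := ⟨_, rfl⟩
  have hB₁1 : 1 ≤ B₁ := by rw [hB₁]; exact le_max_right _ _
  have hBB₁ : B ≤ B₁ := by rw [hB₁]; exact le_max_left _ _
  have hB₁0 : 0 < B₁ := by linarith
  -- tolerances, the level-`s` `W`-tricked statement, the singular series cutoff
  have hε₁ : 0 < ε / (4 * B₁ * 2 ^ d) := by positivity
  have hε₂ : 0 < ε / (4 * 3 ^ d) := by positivity
  obtain ⟨L', hL'⟩ : ∃ L' : ℕ, L' = L + t * (2 * L + 2) := ⟨_, rfl⟩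
  obtain ⟨w₀, N₀, h51'⟩ := h51 d t L' hd ht _ hε₁
  obtain ⟨w₁, hw₁⟩ := singularProduct_sub_partial_uniform t L _ hε₂
  obtain ⟨w, hw⟩ : ∃ w : ℕ, w = max w₀ w₁ := ⟨_, rfl⟩
  have hw₀w : w₀ ≤ w := by rw [hw]; exact le_max_left _ _
  have hw₁w : w₁ ≤ w := by rw [hw]; exact le_max_right _ _
  obtain ⟨W, hWdef⟩ : ∃ W : ℕ, W = primorial w := ⟨_, rfl⟩
  have hW1 : 1 ≤ W := by rw [hWdef]; exact primorial_pos w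
  have hWr1 : (1 : ℝ) ≤ W := by exact_mod_cast hW1
  have hWr0 : (0 : ℝ) < W := by linarith
  have h51w : ∀ N : ℕ, N₀ ≤ N → (w : ℝ) ≤ Real.log (Real.log N) / 2 →
      ∀ Ψ : Fin t → AffLinForm d, IsNondegenerateSystem Ψ → IsNormalForm s Ψ →
        affLinSize Ψ N ≤ L' → ∀ K : Set (Fin d → ℝ), Convex ℝ K → K ⊆ realBox d N →
          (∀ x ∈ K, ∀ i, (N : ℝ) ^ ((7 : ℝ) / 10) < (Ψ i).realEval x) →
          ∀ b : Fin t → ℕ, (∀ i, 1 ≤ b i ∧ b i ≤ W ∧ Nat.Coprime (b i) W) →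
            |∑ n ∈ (latticeBox d N).filter (fun n => realPoint n ∈ K),
                ((∏ i, vonMangoldtW W (b i) ((Ψ i).eval n).toNat) - 1)| ≤
              ε / (4 * B₁ * 2 ^ d) * (N : ℝ) ^ d := by
    rw [hWdef]
    exact fun N hN hr => h51' N hN w hw₀w hr
  -- the crude error terms
  obtain ⟨L₁, hL₁⟩ : ∃ L₁ : ℕ, L₁ = max L 1 := ⟨_, rfl⟩
  have hL₁1 : 1 ≤ L₁ := by rw [hL₁]; exact le_max_right _ _
  have hLL₁ : L ≤ L₁ := by rw [hL₁]; exact le_max_left _ _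
  have hL₁r : (1 : ℝ) ≤ (L₁ : ℝ) := by exact_mod_cast hL₁1
  obtain ⟨A, hA⟩ : ∃ A : ℝ, A = 2 * (L₁ : ℝ) + 2 * t + 2 * B₁ * Cd * (2 * W) ^ d + 1 := ⟨_, rfl⟩
  have hA3_0 : 0 ≤ 2 * B₁ * Cd * (2 * (W : ℝ)) ^ d := by positivity
  have hA1 : 1 ≤ A := by
    rw [hA]; linarith [hA3_0, (by positivity : (0 : ℝ) ≤ 2 * (L₁ : ℝ) + 2 * t)]
  have hA0 : 0 ≤ A := by linarith
  have hA2L : 2 * (L₁ : ℝ) ≤ A := by rw [hA]; linarith [(by positivity : (0 : ℝ) ≤ 2 * t)]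
  have hA2t : 2 * (t : ℝ) ≤ A := by rw [hA]; linarith [(by positivity : (0 : ℝ) ≤ 2 * (L₁ : ℝ))]
  have hA3 : 2 * B₁ * Cd * (2 * (W : ℝ)) ^ d ≤ A := by
    rw [hA]; linarith [(by positivity : (0 : ℝ) ≤ 2 * (L₁ : ℝ) + 2 * t)]
  obtain ⟨N₂, hN₂⟩ := slab_error_eventually hA1 hL₁r (by positivity : 0 < ε / 4) d (t + 1) hd
  obtain ⟨E, hE⟩ : ∃ E : ℕ, E = ⌈Real.exp (Real.exp (2 * w))⌉₊ := ⟨_, rfl⟩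
  -- the threshold
  refine ⟨max (W * N₀) (max (W * E) (max ((4 * W) ^ 10) N₂)), fun N hN Ψ hΨ hnf hL K hK hKN hpos => ?_⟩
  have hNN₀ : W * N₀ ≤ N := le_trans (le_max_left _ _) hN
  have hNE : W * E ≤ N := le_trans ((le_max_left _ _).trans (le_max_right _ _)) hN
  have hN4W : (4 * W) ^ 10 ≤ N :=
    le_trans (((le_max_left _ _).trans (le_max_right _ _)).trans (le_max_right _ _)) hN
  have hN₂N : N₂ ≤ N :=
    le_trans (((le_max_right _ _).trans (le_max_right _ _)).trans (le_max_right _ _)) hN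
  have h4W10 : 4 * W ≤ (4 * W) ^ 10 := Nat.le_self_pow (by norm_num) _
  have hN1 : 1 ≤ N := by omega
  have hN2W : 2 * W ≤ N := by omega
  have hNr1 : (1 : ℝ) ≤ N := by exact_mod_cast hN1
  have hNr0 : (0 : ℝ) < N := by linarith
  -- the scale `Ñ = ⌊N/W⌋ + 2`
  obtain ⟨Ñ, hÑ⟩ : ∃ Ñ : ℕ, Ñ = N / W + 2 := ⟨_, rfl⟩
  have hÑN₀ : N₀ ≤ Ñ := by
    have : N₀ ≤ N / W := (Nat.le_div_iff_mul_le (by omega)).mpr (by rw [mul_comm]; exact hNN₀)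
    omega
  have hÑr : (N : ℝ) / W + 1 ≤ Ñ := by rw [hÑ]; exact div_add_one_le_wScale hW1 N
  have hNWÑ : (N : ℝ) / W ≤ Ñ := by linarith
  have hÑ1 : (1 : ℝ) ≤ Ñ := by
    have : 0 ≤ (N : ℝ) / W := by positivity
    linarith
  have hÑ0 : (0 : ℝ) ≤ Ñ := by linarith
  have hÑnat1 : 1 ≤ Ñ := by rw [hÑ]; exact le_trans (by norm_num : 1 ≤ 2) (Nat.le_add_left 2 _)
  have hWÑ : (W : ℝ) * Ñ ≤ 2 * N := by
    rw [hÑ]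
    have h1 : (W : ℝ) * ((N / W : ℕ) : ℝ) ≤ N := by exact_mod_cast Nat.mul_div_le N W
    have h2 : ((2 * W : ℕ) : ℝ) ≤ N := by exact_mod_cast hN2W
    push_cast at h2 ⊢
    have h3 : (W : ℝ) * (((N / W : ℕ) : ℝ) + 2) = (W : ℝ) * ((N / W : ℕ) : ℝ) + 2 * W := by ring
    rw [h3]
    linarith
  -- the cutoff `w` is admissible at scale `Ñ`
  have hrange : (w : ℝ) ≤ Real.log (Real.log Ñ) / 2 := by
    have h1 : E ≤ N / W := (Nat.le_div_iff_mul_le (by omega)).mpr (by rw [mul_comm]; exact hNE)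
    have h2 : Real.exp (Real.exp (2 * w)) ≤ Ñ := by
      calc Real.exp (Real.exp (2 * w)) ≤ E := by rw [hE]; exact Nat.le_ceil _
        _ ≤ ((N / W : ℕ) : ℝ) := by exact_mod_cast h1
        _ ≤ Ñ := by rw [hÑ]; push_cast; linarith
    have h3 : Real.exp (2 * w) ≤ Real.log Ñ := by
      rw [Real.le_log_iff_exp_le (by positivity)]
      exact h2
    have h4 : (2 * w : ℝ) ≤ Real.log (Real.log Ñ) := by
      rw [Real.le_log_iff_exp_le (lt_of_lt_of_le (Real.exp_pos _) h3)]
      exact h3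
    linarith
  -- coefficient bound, finite complexity, `β_W`, the singular product
  have hcoef : ∀ i j, ((Ψ i).coeff j).natAbs ≤ L := fun i j =>
    natAbs_coeff_le_of_affLinSize_le hL i j
  have hfc : IsFiniteComplexitySystem Ψ := hnf.isFiniteComplexitySystem
  have hβW : localFactor Ψ W = singularProductPartial Ψ w := by
    rw [hWdef]; exact localFactor_primorial Ψ w
  have hβWB : localFactor Ψ W ≤ B := by rw [hβW]; exact (hB d Ψ hΨ hfc hcoef w).2
  have hSβ : |singularProduct Ψ - localFactor Ψ W| ≤ ε / (4 * 3 ^ d) := by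
    rw [hβW]; exact hw₁ d Ψ hΨ hfc hcoef w hw₁w
  -- `N^{8/10} > W`
  have hN8W : (W : ℝ) < (N : ℝ) ^ ((8 : ℝ) / 10) := by
    have h1 : ((4 * W : ℕ) : ℝ) ^ (10 : ℕ) ≤ N := by exact_mod_cast hN4W
    have h2 : (4 : ℝ) * W ≤ (N : ℝ) ^ ((1 : ℝ) / 10) := by
      have h3 : (0 : ℝ) ≤ ((4 * W : ℕ) : ℝ) := Nat.cast_nonneg _
      calc (4 : ℝ) * W = ((((4 * W : ℕ) : ℝ)) ^ (10 : ℕ)) ^ ((1 : ℝ) / 10) := by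
            rw [← Real.rpow_natCast, ← Real.rpow_mul h3]
            norm_num
        _ ≤ (N : ℝ) ^ ((1 : ℝ) / 10) := Real.rpow_le_rpow (by positivity) h1 (by norm_num)
    have h4 : (N : ℝ) ^ ((1 : ℝ) / 10) ≤ (N : ℝ) ^ ((8 : ℝ) / 10) :=
      Real.rpow_le_rpow_of_exponent_le hNr1 (by norm_num)
    linarith
  -- the residue sets and the pieces of the sum
  have haW : ∀ a ∈ Fintype.piFinset (fun _ : Fin d => Finset.range W), ∀ j, a j < W :=
    fun a ha j => Finset.mem_range.mp (Fintype.mem_piFinset.mp ha j)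
  have hKBpos : ∀ a ∈ Fintype.piFinset (fun _ : Fin d => Finset.range W),
      ∀ m ∈ (latticeBox d Ñ).filter (fun m => realPoint m ∈ wTrickBody W a K), ∀ i,
      ((Ñ : ℝ)) ^ ((7 : ℝ) / 10) < (((Ψ i).wTrickShift W a).eval m : ℝ) ∧
        (W : ℤ) < (Ψ i).eval (fun j => (W : ℤ) * m j + (a j : ℤ)) := by
    intro a ha m hm i
    have hmK : realPoint m ∈ wTrickBody W a K := (Finset.mem_filter.mp hm).2
    rw [mem_wTrickBody] at hmK
    have h1 := hpos _ hmK i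
    rw [realEval_wTrick, realEval_realPoint] at h1
    have hbr : ((wTrickResidue (Ψ i) W a : ℤ) : ℝ) ≤ W := by
      exact_mod_cast (wTrickResidue_mem hW1 (Ψ i) a).2
    refine ⟨?_, ?_⟩
    · rw [hÑ]
      exact wScale_rpow_lt hW1 hN4W hbr h1
    · have h2 : ((W : ℤ) : ℝ) < (((Ψ i).eval fun j => (W : ℤ) * m j + (a j : ℤ)) : ℝ) := by
        rw [eval_wTrick]
        push_cast
        linarith
      exact_mod_cast h2
  -- Step 1: `Λ → Λ'`
  have e1 := vonMangoldtSum_sub_primeSum_le hΨ hN1 hL₁1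
    (hL.trans (by exact_mod_cast hLL₁ : ((L : ℕ) : ℝ) ≤ L₁)) K
  -- Step 2: the expansion (5.5) and (5.6)
  have hexp : ∑ n ∈ (latticeBox d N).filter (fun n => realPoint n ∈ K),
      ∏ i, vonMangoldtPrime ((Ψ i).eval n).toNat =
      ∑ a ∈ (Fintype.piFinset (fun _ : Fin d => Finset.range W)).filter
        (fun a => ∀ i, Int.gcd ((Ψ i).eval fun j => (a j : ℤ)) W = 1),
        ((W : ℝ) / Nat.totient W) ^ t *
          ∑ m ∈ (latticeBox d Ñ).filter (fun m => realPoint m ∈ wTrickBody W a K),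
            ∏ i, vonMangoldtW W (wTrickResidue (Ψ i) W a).toNat
              (((Ψ i).wTrickShift W a).eval m).toNat := by
    have h1 := sum_filter_latticeBox_eq_sum_residues (M := ℝ) hW1 hKN
      (fun n => ∏ i, vonMangoldtPrime ((Ψ i).eval n).toNat)
    rw [← hÑ] at h1
    rw [h1]
    have hzero : ∀ a ∈ Fintype.piFinset (fun _ : Fin d => Finset.range W),
        a ∉ (Fintype.piFinset (fun _ : Fin d => Finset.range W)).filter
          (fun a => ∀ i, Int.gcd ((Ψ i).eval fun j => (a j : ℤ)) W = 1) →
        ∑ m ∈ (latticeBox d Ñ).filter (fun m => realPoint m ∈ wTrickBody W a K),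
          ∏ i, vonMangoldtPrime ((Ψ i).eval fun j => (W : ℤ) * m j + (a j : ℤ)).toNat = 0 := by
      intro a ha hA
      have hA' : ¬ ∀ i, Int.gcd ((Ψ i).eval fun j => (a j : ℤ)) W = 1 := fun hall =>
        hA (Finset.mem_filter.mpr ⟨ha, hall⟩)
      exact Finset.sum_eq_zero fun m hm =>
        prod_vonMangoldtPrime_wTrick_eq_zero hW1 hA' fun i => (hKBpos a ha m hm i).2
    have hin : ∀ a ∈ (Fintype.piFinset (fun _ : Fin d => Finset.range W)).filter
          (fun a => ∀ i, Int.gcd ((Ψ i).eval fun j => (a j : ℤ)) W = 1),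
        ∑ m ∈ (latticeBox d Ñ).filter (fun m => realPoint m ∈ wTrickBody W a K),
          ∏ i, vonMangoldtPrime ((Ψ i).eval fun j => (W : ℤ) * m j + (a j : ℤ)).toNat =
        ((W : ℝ) / Nat.totient W) ^ t *
          ∑ m ∈ (latticeBox d Ñ).filter (fun m => realPoint m ∈ wTrickBody W a K),
            ∏ i, vonMangoldtW W (wTrickResidue (Ψ i) W a).toNat
              (((Ψ i).wTrickShift W a).eval m).toNat := by
      intro a hA
      have ha := (Finset.mem_filter.mp hA).1
      rw [Finset.mul_sum]
      refine Finset.sum_congr rfl fun m hm => prod_vonMangoldtPrime_wTrick_eq hW1 a fun i => ?_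
      have h2 := (hKBpos a ha m hm i).1
      have h3 : (0 : ℝ) < (((Ψ i).wTrickShift W a).eval m : ℝ) :=
        lt_of_le_of_lt (Real.rpow_nonneg hÑ0 _) h2
      exact_mod_cast h3.le
    rw [← Finset.sum_subset (Finset.filter_subset _ _) hzero]
    exact Finset.sum_congr rfl hin
  -- Step 3: Thm. 5.1 for each `a ∈ A` at scale `Ñ`
  have h51a : ∀ a ∈ (Fintype.piFinset (fun _ : Fin d => Finset.range W)).filter
        (fun a => ∀ i, Int.gcd ((Ψ i).eval fun j => (a j : ℤ)) W = 1),
      |(∑ m ∈ (latticeBox d Ñ).filter (fun m => realPoint m ∈ wTrickBody W a K),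
          ∏ i, vonMangoldtW W (wTrickResidue (Ψ i) W a).toNat
            (((Ψ i).wTrickShift W a).eval m).toNat) -
        (#((latticeBox d Ñ).filter (fun m => realPoint m ∈ wTrickBody W a K)) : ℝ)| ≤
      ε / (4 * B₁ * 2 ^ d) * (Ñ : ℝ) ^ d := by
    intro a hA
    obtain ⟨ha, hgcd⟩ := Finset.mem_filter.mp hA
    have hτc : (∑ m ∈ (latticeBox d Ñ).filter (fun m => realPoint m ∈ wTrickBody W a K),
          ∏ i, vonMangoldtW W (wTrickResidue (Ψ i) W a).toNat
            (((Ψ i).wTrickShift W a).eval m).toNat) -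
        (#((latticeBox d Ñ).filter (fun m => realPoint m ∈ wTrickBody W a K)) : ℝ) =
        ∑ m ∈ (latticeBox d Ñ).filter (fun m => realPoint m ∈ wTrickBody W a K),
          ((∏ i, vonMangoldtW W (wTrickResidue (Ψ i) W a).toNat
            (((Ψ i).wTrickShift W a).eval m).toNat) - 1) := by
      rw [Finset.sum_sub_distrib, Finset.sum_const, nsmul_eq_mul, mul_one]
    rw [hτc]
    refine h51w Ñ hÑN₀ hrange (fun i => (Ψ i).wTrickShift W a)
      (isNondegenerateSystem_wTrickShift hΨ hnf W a) (hnf.wTrickShift W a) ?_ (wTrickBody W a K)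
      (convex_wTrickBody W a hK) ?_ ?_ (fun i => (wTrickResidue (Ψ i) W a).toNat) ?_
    · rw [hL']
      exact affLinSize_wTrickShift_le hN1 hW1 hL (haW a ha) hÑ1 hNWÑ
    · rw [hÑ]
      exact wTrickBody_subset_realBox hW1 (haW a ha) hKN
    · intro x hx i
      rw [mem_wTrickBody] at hx
      have h1 := hpos _ hx i
      rw [realEval_wTrick] at h1
      have hbr : ((wTrickResidue (Ψ i) W a : ℤ) : ℝ) ≤ W := by
        exact_mod_cast (wTrickResidue_mem hW1 (Ψ i) a).2
      rw [hÑ]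
      exact wScale_rpow_lt hW1 hN4W hbr h1
    · intro i
      have hb := wTrickResidue_mem hW1 (Ψ i) a
      refine ⟨by omega, by omega, ?_⟩
      have h1 : Int.gcd (((wTrickResidue (Ψ i) W a).toNat : ℕ) : ℤ) (W : ℤ) = 1 := by
        rw [Int.toNat_of_nonneg (by omega), gcd_wTrickResidue]
        exact hgcd i
      rwa [Int.gcd_natCast_natCast] at h1
  -- Step 4: the error of Thm. 5.1 summed over `A`: `|A| (W/φ(W))ᵗ ε₁ Ñ^d = β_W W^d ε₁ Ñ^d`
  have hρ0 : 0 ≤ ((W : ℝ) / Nat.totient W) ^ t := by positivity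
  have hcardA : (#((Fintype.piFinset (fun _ : Fin d => Finset.range W)).filter
        (fun a => ∀ i, Int.gcd ((Ψ i).eval fun j => (a j : ℤ)) W = 1)) : ℝ) *
      ((W : ℝ) / Nat.totient W) ^ t = localFactor Ψ W * (W : ℝ) ^ d := by
    rw [localFactor_eq_card_coprimeResidues]
    field_simp
  have hβW0 : 0 ≤ localFactor Ψ W := localFactor_nonneg Ψ W
  have e2 : |(∑ a ∈ (Fintype.piFinset (fun _ : Fin d => Finset.range W)).filter
        (fun a => ∀ i, Int.gcd ((Ψ i).eval fun j => (a j : ℤ)) W = 1),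
        ((W : ℝ) / Nat.totient W) ^ t *
          ∑ m ∈ (latticeBox d Ñ).filter (fun m => realPoint m ∈ wTrickBody W a K),
            ∏ i, vonMangoldtW W (wTrickResidue (Ψ i) W a).toNat
              (((Ψ i).wTrickShift W a).eval m).toNat) -
      ∑ a ∈ (Fintype.piFinset (fun _ : Fin d => Finset.range W)).filter
        (fun a => ∀ i, Int.gcd ((Ψ i).eval fun j => (a j : ℤ)) W = 1),
        ((W : ℝ) / Nat.totient W) ^ t *
          (#((latticeBox d Ñ).filter (fun m => realPoint m ∈ wTrickBody W a K)) : ℝ)| ≤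
      ε / 4 * (N : ℝ) ^ d := by
    refine (abs_sum_mul_sub_sum_mul_le _ hρ0 _ _ h51a).trans ?_
    calc (#((Fintype.piFinset (fun _ : Fin d => Finset.range W)).filter
          (fun a => ∀ i, Int.gcd ((Ψ i).eval fun j => (a j : ℤ)) W = 1)) : ℝ) *
          (((W : ℝ) / Nat.totient W) ^ t * (ε / (4 * B₁ * 2 ^ d) * (Ñ : ℝ) ^ d))
        = (#((Fintype.piFinset (fun _ : Fin d => Finset.range W)).filter
            (fun a => ∀ i, Int.gcd ((Ψ i).eval fun j => (a j : ℤ)) W = 1)) : ℝ) *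
            ((W : ℝ) / Nat.totient W) ^ t * (ε / (4 * B₁ * 2 ^ d) * (Ñ : ℝ) ^ d) := by ring
      _ = localFactor Ψ W * (W : ℝ) ^ d * (ε / (4 * B₁ * 2 ^ d) * (Ñ : ℝ) ^ d) := by rw [hcardA]
      _ = localFactor Ψ W * (ε / (4 * B₁ * 2 ^ d)) * ((W : ℝ) * Ñ) ^ d := by rw [mul_pow]; ring
      _ ≤ B * (ε / (4 * B₁ * 2 ^ d)) * (2 * N) ^ d := by
          refine mul_le_mul (mul_le_mul_of_nonneg_right hβWB (by positivity))
            (pow_le_pow_left₀ (by positivity) hWÑ d) (by positivity) (by positivity)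
      _ = (B / B₁) * (ε / 4) * (N : ℝ) ^ d := by
          rw [mul_pow]
          field_simp
      _ ≤ 1 * (ε / 4) * (N : ℝ) ^ d := by
          refine mul_le_mul_of_nonneg_right (mul_le_mul_of_nonneg_right ?_ (by positivity))
            (by positivity)
          exact (div_le_one hB₁0).mpr hBB₁
      _ = ε / 4 * (N : ℝ) ^ d := by ring
  -- Step 5: the main terms `∑_{a ∈ A} (W/φ(W))ᵗ #(K̃_a ∩ ℤ^d)` and `#(K ∩ ℤ^d) β_W`
  have hcKβ : (latticePointCount K N : ℝ) * localFactor Ψ W =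
      ∑ _a ∈ (Fintype.piFinset (fun _ : Fin d => Finset.range W)).filter
        (fun a => ∀ i, Int.gcd ((Ψ i).eval fun j => (a j : ℤ)) W = 1),
        ((W : ℝ) / Nat.totient W) ^ t * ((latticePointCount K N : ℝ) / (W : ℝ) ^ d) := by
    rw [Finset.sum_const, nsmul_eq_mul, localFactor_eq_card_coprimeResidues]
    field_simp
  have hlat : ∀ a ∈ (Fintype.piFinset (fun _ : Fin d => Finset.range W)).filter
        (fun a => ∀ i, Int.gcd ((Ψ i).eval fun j => (a j : ℤ)) W = 1),
      |(#((latticeBox d Ñ).filter (fun m => realPoint m ∈ wTrickBody W a K)) : ℝ) -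
        (latticePointCount K N : ℝ) / (W : ℝ) ^ d| ≤
      Cd * (Ñ : ℝ) ^ (d - 1) + Cd * (N : ℝ) ^ (d - 1) := by
    intro a hA
    have ha := (Finset.mem_filter.mp hA).1
    have h1 := hCd Ñ hÑnat1 (wTrickBody W a K) (convex_wTrickBody W a hK)
      (by rw [hÑ]; exact wTrickBody_subset_realBox hW1 (haW a ha) hKN)
    rw [volume_wTrickBody_toReal hW1] at h1
    have h2 : |(latticePointCount K N : ℝ) - (volume K).toReal| ≤ Cd * (N : ℝ) ^ (d - 1) :=
      hCd N hN1 K hK hKN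
    have hWd : (1 : ℝ) ≤ (W : ℝ) ^ d := one_le_pow₀ hWr1
    have h3 : |(volume K).toReal / (W : ℝ) ^ d - (latticePointCount K N : ℝ) / (W : ℝ) ^ d| ≤
        Cd * (N : ℝ) ^ (d - 1) := by
      rw [← sub_div, abs_div, abs_of_pos (by positivity : (0 : ℝ) < (W : ℝ) ^ d), abs_sub_comm]
      exact (div_le_self (abs_nonneg _) hWd).trans h2
    exact (abs_sub_le _ _ _).trans (add_le_add h1 h3)
  have e3 : |(∑ a ∈ (Fintype.piFinset (fun _ : Fin d => Finset.range W)).filter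
        (fun a => ∀ i, Int.gcd ((Ψ i).eval fun j => (a j : ℤ)) W = 1),
        ((W : ℝ) / Nat.totient W) ^ t *
          (#((latticeBox d Ñ).filter (fun m => realPoint m ∈ wTrickBody W a K)) : ℝ)) -
      (latticePointCount K N : ℝ) * localFactor Ψ W| ≤
      2 * B₁ * Cd * (2 * (W : ℝ)) ^ d * (N : ℝ) ^ (d - 1) := by
    rw [hcKβ]
    refine (abs_sum_mul_sub_sum_mul_le _ hρ0 _ _ hlat).trans ?_
    calc (#((Fintype.piFinset (fun _ : Fin d => Finset.range W)).filter
          (fun a => ∀ i, Int.gcd ((Ψ i).eval fun j => (a j : ℤ)) W = 1)) : ℝ) *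
          (((W : ℝ) / Nat.totient W) ^ t * (Cd * (Ñ : ℝ) ^ (d - 1) + Cd * (N : ℝ) ^ (d - 1)))
        = localFactor Ψ W * Cd * ((W : ℝ) ^ d * (Ñ : ℝ) ^ (d - 1) + (W : ℝ) ^ d * (N : ℝ) ^ (d - 1)) := by
          rw [← mul_assoc, hcardA]; ring
      _ ≤ B₁ * Cd * (2 * (2 * (W : ℝ)) ^ d * (N : ℝ) ^ (d - 1)) := by
          refine mul_le_mul (mul_le_mul_of_nonneg_right (hβWB.trans hBB₁) hCd0)
            (wpow_scale_le hd hWr1 hÑ0 hNr0.le hWÑ) (by positivity) (by positivity)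
      _ = 2 * B₁ * Cd * (2 * (W : ℝ)) ^ d * (N : ℝ) ^ (d - 1) := by ring
  -- Step 6: `β_W` versus `∏_p β_p`
  have e4 : |(latticePointCount K N : ℝ) * localFactor Ψ W -
      (latticePointCount K N : ℝ) * singularProduct Ψ| ≤ ε / 4 * (N : ℝ) ^ d := by
    rw [← mul_sub, abs_mul, abs_of_nonneg (Nat.cast_nonneg _), abs_sub_comm]
    calc (latticePointCount K N : ℝ) * |singularProduct Ψ - localFactor Ψ W|
        ≤ ((3 : ℝ) ^ d * (N : ℝ) ^ d) * (ε / (4 * 3 ^ d)) :=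
          mul_le_mul (latticePointCount_le K hN1) hSβ (abs_nonneg _) (by positivity)
      _ = ε / 4 * (N : ℝ) ^ d := by
          field_simp
  -- Step 7: the crude terms are `o(N^d)`
  have hslab := hN₂ N hN₂N
  have hP0 : (0 : ℝ) ≤ (2 * (N : ℝ) + 1) ^ (d - 1) := by positivity
  have hG1 : (1 : ℝ) ≤ (A * N) ^ ((8 : ℝ) / 10) + 1 := by
    have : 0 ≤ (A * N) ^ ((8 : ℝ) / 10) := Real.rpow_nonneg (by positivity) _
    linarith
  have hlog0 : 0 ≤ Real.log (2 * (L₁ : ℝ) * N) := by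
    apply Real.log_nonneg
    have : (1 : ℝ) ≤ (L₁ : ℝ) * N := one_le_mul_of_one_le_of_one_le hL₁r hNr1
    linarith
  have hLg1 : (1 : ℝ) ≤ (1 + Real.log (2 * (L₁ : ℝ) * N)) ^ (t + 1) := one_le_pow₀ (by linarith)
  have e1' : vonMangoldtSum Ψ K N - ∑ n ∈ (latticeBox d N).filter (fun n => realPoint n ∈ K),
        ∏ i, vonMangoldtPrime ((Ψ i).eval n).toNat ≤ ε / 4 * (N : ℝ) ^ d := by
    refine e1.2.trans ((primePower_error_le hN1 hL₁1 hA2L hP0).trans (le_trans ?_ hslab))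
    -- `2t ≤ A`
    have h1 : 0 ≤ ((A * N) ^ ((8 : ℝ) / 10) + 1) * (2 * (N : ℝ) + 1) ^ (d - 1) *
        (1 + Real.log (2 * (L₁ : ℝ) * N)) ^ (t + 1) := by positivity
    calc 2 * (t : ℝ) * ((A * N) ^ ((8 : ℝ) / 10) + 1) * (2 * (N : ℝ) + 1) ^ (d - 1) *
          (1 + Real.log (2 * (L₁ : ℝ) * N)) ^ (t + 1)
        = (2 * (t : ℝ)) * (((A * N) ^ ((8 : ℝ) / 10) + 1) * (2 * (N : ℝ) + 1) ^ (d - 1) *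
            (1 + Real.log (2 * (L₁ : ℝ) * N)) ^ (t + 1)) := by ring
      _ ≤ A * (((A * N) ^ ((8 : ℝ) / 10) + 1) * (2 * (N : ℝ) + 1) ^ (d - 1) *
            (1 + Real.log (2 * (L₁ : ℝ) * N)) ^ (t + 1)) := mul_le_mul_of_nonneg_right hA2t h1
      _ = _ := by ring
  have e3' : 2 * B₁ * Cd * (2 * (W : ℝ)) ^ d * (N : ℝ) ^ (d - 1) ≤ ε / 4 * (N : ℝ) ^ d := by
    refine le_trans ?_ hslab
    have hNP : (N : ℝ) ^ (d - 1) ≤ (2 * (N : ℝ) + 1) ^ (d - 1) :=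
      pow_le_pow_left₀ hNr0.le (by linarith) _
    calc 2 * B₁ * Cd * (2 * (W : ℝ)) ^ d * (N : ℝ) ^ (d - 1)
        ≤ A * (2 * (N : ℝ) + 1) ^ (d - 1) := mul_le_mul hA3 hNP (by positivity) hA0
      _ = A * 1 * (2 * (N : ℝ) + 1) ^ (d - 1) * 1 := by ring
      _ ≤ A * ((A * N) ^ ((8 : ℝ) / 10) + 1) * (2 * (N : ℝ) + 1) ^ (d - 1) *
            (1 + Real.log (2 * (L₁ : ℝ) * N)) ^ (t + 1) := by
          refine mul_le_mul (mul_le_mul_of_nonneg_right (mul_le_mul_of_nonneg_left hG1 hA0) hP0)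
            hLg1 zero_le_one (by positivity)
  -- Step 8: assemble
  have hfin : |vonMangoldtSum Ψ K N - (latticePointCount K N : ℝ) * singularProduct Ψ| ≤
      ε / 4 * (N : ℝ) ^ d + ε / 4 * (N : ℝ) ^ d + 2 * B₁ * Cd * (2 * (W : ℝ)) ^ d * (N : ℝ) ^ (d - 1) +
        ε / 4 * (N : ℝ) ^ d := by
    have t1 : |vonMangoldtSum Ψ K N - ∑ n ∈ (latticeBox d N).filter (fun n => realPoint n ∈ K),
        ∏ i, vonMangoldtPrime ((Ψ i).eval n).toNat| ≤ ε / 4 * (N : ℝ) ^ d := by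
      rw [abs_of_nonneg e1.1]; exact e1'
    rw [hexp] at t1
    calc |vonMangoldtSum Ψ K N - (latticePointCount K N : ℝ) * singularProduct Ψ|
        ≤ |vonMangoldtSum Ψ K N - (latticePointCount K N : ℝ) * localFactor Ψ W| +
          |(latticePointCount K N : ℝ) * localFactor Ψ W -
            (latticePointCount K N : ℝ) * singularProduct Ψ| := abs_sub_le _ _ _
      _ ≤ (|vonMangoldtSum Ψ K N - _| + (|_ - _| + |_ - (latticePointCount K N : ℝ) * localFactor Ψ W|)) +
          ε / 4 * (N : ℝ) ^ d :=
          add_le_add ((abs_sub_le _ _ _).trans (add_le_add le_rfl (abs_sub_le _ _ _))) e4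
      _ ≤ (ε / 4 * (N : ℝ) ^ d + (ε / 4 * (N : ℝ) ^ d +
          2 * B₁ * Cd * (2 * (W : ℝ)) ^ d * (N : ℝ) ^ (d - 1))) + ε / 4 * (N : ℝ) ^ d :=
          add_le_add (add_le_add t1 (add_le_add e2 e3)) le_rfl
      _ = _ := by ring
  calc |vonMangoldtSum Ψ K N - (latticePointCount K N : ℝ) * singularProduct Ψ|
      ≤ _ := hfin
    _ ≤ ε / 4 * (N : ℝ) ^ d + ε / 4 * (N : ℝ) ^ d + ε / 4 * (N : ℝ) ^ d + ε / 4 * (N : ℝ) ^ d := by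
        linarith [e3']
    _ = ε * (N : ℝ) ^ d := by ring

end Literature.NumberTheory.Sieve
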